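import Summits.QuantumFields.YangMills.Theorems.FluctuationComparisonRegPrIntLOddsLedgerPregLow
import Summits.QuantumFields.YangMills.Theorems.FluctuationComparisonRegPrIntLWreg
import Summits.QuantumFields.YangMills.Theorems.FluctuationComparisonRegPrIntLSupTailReduction
import Summits.QuantumFields.YangMills.Theorems.UnitScaleTiltFluctuationComparisonRegPrOneTower
import HarnessLib

/-!
# LINE g21-2 «DEPTH-ONE WINDOW ODDS BY A MEASURE SPLIT» — the first rung TAILSUP₁ of LINE g21-1 («SUP-TAIL × CRUDE LOCALITY») reduced, with a
# PROVED measure-to-pointwise upgrade, to TWO relative large-field bounds AT THE LEVEL OF MEASURES: a MODERATE-field (Laplace) row and a FAR-field (action-cost) row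
(ideator `ym-r3-idea-1` g21, lens «control»; crux `stmt-QuantumFields-20520` = `UnitScaleTilt.FluctuationComparisonRegPrIntL`, rung R3 = continuum SU(2) YM₃ on T³)

TARGET (concluded BY NAME, text byte-identical): **TAILSUP₁** `WindowOddsSupDepthOneCan` of LINE g21-1 `Lines/suptail_split.lean` §1 (there PROVED to follow
from TAILSUP `WindowOddsSupCan`, ✓`windowOddsSupDepthOne_of`; named there as the hands' entry), restated VERBATIM in §1 with its `heightDensityCan` (§0).
It says: on the runs `K = J + 1`, for every continuous positive window version `ρ` of the height-`J` law and positivity of the canonical small-history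
density on the window, `∃ c, ∀ U ∈ window, 0 ≤ log ρ U − c − log q^{hist}_can U ≤ τ_J` with `τ_J` super-polynomially small — the CONDITIONAL ODDS, given the
window datum, that some run-`(J+1)` plaquette leaves `θ_{J+1}`.

THE LEVER (control: pick the currency in which the glue is additive).  Pointwise statements about canonical versions of restricted densities do not ADD
(the WREG∕PREG swamp: `canonVersion` of a sum is not the sum of `canonVersion`s off the regular sets); MEASURES do.  So the two rows are typed as
inequalities between the DESCENDED RESTRICTED GIBBS MEASURES on the level-`J` fields, restricted to the window `W_J := {PlaqSmall θ_J}`: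
  MOD₁ `ModerateFieldOddsDepthOneCan`:  `(D_*(G|{¬hist} ∩ {PlaqSmall δ₀}))|W ≤ σ₁(J)·(D_*(G|hist))|W`  for SOME `δ₀ > 0` (the convexity radius of the one-step
        action on the constrained fibre): moderate large fields — at least one fine plaquette beyond `θ_{J+1}` but all within `δ₀` — are a `σ₁(J) ≍ N_{J+1}e^{−c p₀(g_{J+1})²}`
        fraction of the good ones, by a Laplace∕Gaussian tail RELATIVE to the small-field term ([Balaban1985UV3] (38)–(41) p.266: positivity of the fluctuation
        operator for small fields; the NeumannFRD covariance of crux idea #158 is the Gaussian proxy);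
  FAR₁ `FarFieldOddsDepthOneCan`:  `(D_*(G|{¬PlaqSmall δ₀}))|W ≤ σ₂(J)·(D_*(G|hist))|W`  for EVERY `δ₀ > 0` (coupling threshold `γ₁(δ₀)` after `δ₀`): a plaquette of
        size `≥ δ₀` costs `≥ c δ₀²∕g²_{J+1}` of action — `σ₂(J) ≍ N_{J+1}e^{−c(δ₀)∕g²_{J+1}}`, a Peierls-type «remove the bad plaquette» RELATIVE bound on the fibre
        ([Balaban1985UV3] (7) p.257 decomposition of unity; [Balaban1989LargeFieldII] (1.95) p.389).
  GLUE (PROVED, §3–§4 ✓`windowOddsSupDepthOne_of_split : SplitOneSuffices`): `univ ⊆ hist ∪ E_mod ∪ E_far` ⇒ measure subadditivity ⇒ `(D_*G)|W ≤ (1+σ₁+σ₂)·(D_*(G|hist))|W`;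
        both sides have the `withDensity` presentation ✓`map_descendTo_restrict_eq_withDensity` ⇒ `heightDensity^{univ} ≤ (1+σ₁+σ₂)·heightDensity^{hist}` a.e. on `W`
        (✓`ae_le_of_forall_setLIntegral_le_of_sigmaFinite`) and `heightDensity^{hist} ≤ heightDensity^{univ}` a.e. (✓`heightDensity_mono_ae`, px16); the canonical
        versions are CONTINUOUS on the open window — `q^{hist}_can` by ✓WREG `windowRegularity` (window ⊆ `regSet`), `q^{univ}_can = Z·ρ` there by
        ✓`subset_regSet_heightDensity_univ_of_version` (px16; VERS's mechanism ✓p752318) — so a.e. upgrades to EVERY window point (open-positive Haar,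
        ✓`le_of_ae_le_of_continuousOn` below); finally `c := −log Z_{J+1}` and `τ_J := log(1 + σ₁ J + σ₂ J) ≤ σ₁ J + σ₂ J` (super-polynomial ✓).
So TAILSUP₁ ⟸ MOD₁ ∧ FAR₁ with everything else PROVED; the two rows are regime pieces of one conditional large-deviation bound, each strictly weaker than
TAILSUP₁ (measure-level, one regime), typed over the tree's `gibbsK`, `descendTo`, `histGood`, `PlaqSmall` only — no versions, no `ρ`, no `∃ c`.

WHY EASIER ∕ WHY USEFUL.  The hands' recorded difficulty on this crux is the pointwise∕version layer (WREG took a week; PREG split into ends + PWREG); this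
file removes that layer from the depth-one tail problem ONCE, by proof, and leaves two inequalities between explicit finite-dimensional integrals over the
one-step constrained fibre — the currency of [Balaban1985UV3] §3 and of the tree's one-step tools (`T3ConstrainedMinimiser.fibre`, WREG's window charts,
KPL-E ✓p746335, NeumannFRD #158).  Sorries (v1–v1.3) = {MOD₁ `stub_moderateFieldOddsDepthOneCan` (L), FAR₁ `stub_farFieldOddsDepthOneCan` (M–L)}; 0 elsewhere.

v1.4 (2026-08-30T02:4xZ, AFTER ROW «R3-FLIN» j337502 — falsifier (a) FIRES in the linearised toy at `L = 3`: `c_lin(3,4) ≥ 8.56 > 3^{3/2}`; the pen's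
sealed prediction `c_lin(L) < L` MISSED).  §4e adds the INTERIOR-WINDOW rows TAILSUP₁∘ `WindowOddsSupDepthOneIntCan`, MOD₁∘ `ModerateFieldOddsDepthOneIntCan`,
PPT∘ `PinnedModerateOddsDepthOneIntCan` — ONE window fraction `c = c(L) ∈ (0,1]` right after `∀ L` (the crux's own prefix), WINDOW at `θBal F.L γ (c * b₀) p₀ J`,
HISTORY unchanged at `θBal F.L γ b₀ p₀` — with PROVED doors `moderateFieldOddsInt_of_pinned : PPT∘ → MOD₁∘`, `windowOddsSupDepthOneInt_of_split : MOD₁∘ → FAR₁ →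
TAILSUP₁∘`, `windowOddsSupDepthOneInt_of_pinned : PPT∘ → FPT → TAILSUP₁∘`.  v1.5 (02:5xZ, ★★OWNER WORD 81 (3)(c)): the fraction is typed with ONE
SHARED SHAPE per row `∀ L, ∃ c₀, 0 < c₀ ∧ c₀ ≤ 1 ∧ ∀ c, 0 < c → c ≤ c₀ → ∃ pS, …` (closed under shrinking `c` by fiat; a multi-row concluder takes `c := min c₀ᵢ`;
the companion `Lines/interior_table.lean` shows the `b₀∕c` instantiation `1L4ᶜ∘ → H4ᶜ∘ → LFR♯ᶜ∘ → S2β` in the kernel); the v1.4 embeddings `…Int_of_full` are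
WITHDRAWN (under the shared shape the ∘-row and the full-window row are incomparable Props; mathematically the ∘-row is the weaker claim).  The full-window rows MOD₁ ∕ PPT ∕ TAILSUP₁ are EXPOSED AS TYPED at `L = 3` by R3-FLIN's boundary layer (§4e header) and stay on file
byte-identical as the record the toy speaks to; FAR₁ ∕ FPT are immune.  Sorries (v1.4 = v1.5) = {MOD₁ (exposed, of record), FAR₁, MOD₁∘ `stub_moderateFieldOddsDepthOneIntCan`
(the LIVE moderate row)}; 0 elsewhere; by-name concluders `windowOddsSupDepthOneCan_of_stubs` (TAILSUP₁) and `windowOddsSupDepthOneIntCan_of_stubs` (TAILSUP₁∘).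
Whether the consuming chain (⟨COND-ODDS₁⟩ ✓p754917, TAILSUP, LFR♯ᶜ and the one-loop rows of the registry of record) is re-typed on the interior window is the
★★OWNER's decision (registry frozen, RULING №36); this file only supplies the typed, kernel-checked interior rows and doors.
PUBLISHED organ-level line (RULING №36 (3)): NOT registered.  No summit is proved by a line; `YM3TorusSU2` is NOT proved; `FluctuationComparisonRegPrIntL`
(20520), LFR♯ᶜ, TAILSUP are NOT concluded by this file; nothing of Bałaban's asserted; rung R3 (YM₃ on T³) — NOT d = 4, NOT infinite volume, NOT a mass gap, NOT Clay.
-/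

noncomputable section

set_option autoImplicit false

open MeasureTheory Filter Topology Set
open scoped ENNReal NNReal
open Literature.MathematicalPhysics.QuantumFieldTheory.Balaban1983to89
open Literature.MathematicalPhysics.QuantumFieldTheory.Balaban1983to89.T3ContinuumYM3Torus
open Literature.MathematicalPhysics.QuantumFieldTheory.Balaban1983to89.T3NestedUnitLaws
open Literature.MathematicalPhysics.QuantumFieldTheory.Balaban1983to89.T3UnitLawDensityEML
open Literature.MathematicalPhysics.QuantumFieldTheory.Balaban1983to89.T3UnitScaleTilt
open Literature.MathematicalPhysics.QuantumFieldTheory.Balaban1983to89.T3TiltDescent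
open Literature.MathematicalPhysics.QuantumFieldTheory.Balaban1983to89.Missing
open scoped Literature.MathematicalPhysics.QuantumFieldTheory.Balaban1983to89.T3OrbitAverage
open Summit.QuantumFields.YangMills.Theorems.FluctuationComparisonRegPrIntLWregAssembly (isOpen_setOf_plaqSmall₂)
open Summit.QuantumFields.YangMills.Theorems.FluctuationComparisonRegPrIntLOddsLedgerPregLow (heightDensity_mono_ae
  subset_regSet_heightDensity_univ_of_version canonVersion_le_of_ae_le_on)
open Summit.QuantumFields.YangMills.Theorems.FluctuationComparisonRegPrIntLWreg (windowRegularity)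

namespace Summit.QuantumFields.YangMills.Cruxes.FluctuationComparisonRegPrIntL.RunPairOrgan.TailSupOne

/-! ## §0 The canonical version of the restricted height density (verbatim from LINE g18-1 v11 §1 ∕ LINE g21-1 §0a) -/

section Canonical

variable (F : T3Family) (γ : ℝ) {J K : ℕ} (hJK : J ≤ K) (S : Set (GaugeField (F.P K) 0 (Matrix.specialUnitaryGroup (Fin 2) ℂ)))

/-- **THE CANONICAL VERSION OF BAŁABAN'S RESTRICTED DENSITY AT HEIGHT `K − J`** read on the `J`-th tower's finest lattice: the trunk's `heightDensity`
(a chosen Radon–Nikodym version) replaced by `Node00.canonVersion` of its a.e.-class for product Haar — continuous on the maximal open set carrying a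
continuous representative and equal there to every such representative. [cite: Balaban1985UV3, (2) p.256 and (41) p.266] -/
def heightDensityCan (V : GaugeField (F.P J) 0 (Matrix.specialUnitaryGroup (Fin 2) ℂ)) : ℝ :=
  Node00.canonVersion (fieldMeasure (F.P J) 0 (Matrix.specialUnitaryGroup (Fin 2) ℂ)) (heightDensity F γ hJK S) V

end Canonical

/-! ## §1 The TARGET: TAILSUP₁ of LINE g21-1, verbatim -/

/-- **TAILSUP₁ · THE FIRST RUNG** (`WindowOddsSupDepthOneCan`; text byte-identical to LINE g21-1 `Lines/suptail_split.lean` §1): TAILSUP on the runs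
`K = J + 1` only — ONE free level above the window, so the bad history is «some run-`(J+1)` plaquette is large» and the conditional measure given
`V_J = U` is the ONE-STEP constrained fluctuation measure of the tree.  For every block size, profile and small coupling there is a modulus `τ ≥ 0`
decaying faster than every power of the height such that for the tower `ν`, every height `J` and every continuous positive window version `ρ` of
`ν_{J+1,J}`, given positivity of the canonical small-history density on the window: `∃ c, ∀ U ∈ window, 0 ≤ log ρ U − c − log q^{hist}_can U ≤ τ J`.
[cite: Balaban1985UV3, (38)-(40) p.266; Balaban1985Averaging, (10) p.19] -/
def WindowOddsSupDepthOneCan : Prop :=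
  ∀ (L : ℕ), ∃ pS : ℝ, ∀ (b₀ p₀ : ℝ), 0 < b₀ → pS ≤ p₀ → 0 < p₀ →
    ∃ γ₁ : ℝ, 0 < γ₁ ∧ ∀ (F : T3Family) (γ : ℝ), F.L = L → 0 < γ → γ ≤ γ₁ →
      ∃ τ : ℕ → ℝ, (∀ J, 0 ≤ τ J) ∧ (∀ a : ℕ, Tendsto (fun J : ℕ => ((J : ℝ) + 1) ^ a * τ J) atTop (𝓝 0)) ∧
        ∀ (ν : ℕ → (j : ℕ) → Measure (GaugeField (F.P j) 0 (Matrix.specialUnitaryGroup (Fin 2) ℂ))),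
          (∀ K, ν K K = T4GenFunBounds.gibbsMeasure (F.P K) ((F.scheme ℰp γ).β K)) →
          (∀ K j, j < K → ν K j = Measure.map (descend F ℰp j) (ν K (j + 1))) →
          ∀ (J : ℕ) (ρ : GaugeField (F.P J) 0 (Matrix.specialUnitaryGroup (Fin 2) ℂ) → ℝ),
            (∀ U, PlaqSmall (θBal F.L γ b₀ p₀ J) U → 0 < ρ U) →
            ν (J + 1) J = (fieldMeasure _ _ _).withDensity (fun U => ENNReal.ofReal (ρ U)) →
            ContinuousOn ρ {U | PlaqSmall (θBal F.L γ b₀ p₀ J) U} →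
            (∀ U : GaugeField (F.P J) 0 (Matrix.specialUnitaryGroup (Fin 2) ℂ), PlaqSmall (θBal F.L γ b₀ p₀ J) U →
                0 < heightDensityCan F γ (Nat.le_succ J) (histGood F ℰp (θBal F.L γ b₀ p₀) (J + 1) J) U) →
            ∃ c : ℝ, ∀ U : GaugeField (F.P J) 0 (Matrix.specialUnitaryGroup (Fin 2) ℂ), PlaqSmall (θBal F.L γ b₀ p₀ J) U →
              0 ≤ Real.log (ρ U) - c - Real.log (heightDensityCan F γ (Nat.le_succ J) (histGood F ℰp (θBal F.L γ b₀ p₀) (J + 1) J) U) ∧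
              Real.log (ρ U) - c - Real.log (heightDensityCan F γ (Nat.le_succ J) (histGood F ℰp (θBal F.L γ b₀ p₀) (J + 1) J) U) ≤ τ J

/-! ## §2 The two NEW rows, at the level of MEASURES on the level-`J` fields

HONESTY SENTENCE (idea-crit-5 #387 P1, v1.1): MOD₁ ∧ FAR₁ **=** TAILSUP₁ AT MEASURE LEVEL, SPLIT BY REGIME — jointly the two rows are, up to the PROVED upgrade of §4,
the conditional-odds form of TAILSUP₁ (and by a union bound they give the LEAD's setwise ⟨COND-ODDS₁⟩ of ✓`…Theorems.FluctuationComparisonRegPrIntLSupTailReduction.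
windowOddsSupDepthOneCan_of_condGoodOddsDepthOne`, p754917, with `e^{τ J} := 1 + σ₁ J + σ₂ J`); the GAIN is the proved version∕pointwise upgrade + the separation of
the Laplace regime (MOD₁) from the Peierls regime (FAR₁), NOT a mathematically weaker claim — no hand should book the rows as «strictly easier in substance». -/

/-- **MOD₁ · MODERATE LARGE FIELDS ARE A SUPER-POLYNOMIALLY SMALL FRACTION OF THE GOOD ONES, FIBREWISE** (`ModerateFieldOddsDepthOneCan`; size L; NEW).
For every block size there is a profile threshold, and for every admissible profile SOME `δ₀ > 0` (the radius on which the one-step Wilson action on the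
constrained fibre is uniformly convex transversally to the gauge orbit of the minimiser) and a coupling threshold, such that with a modulus `σ₁ ≥ 0`,
`(J+1)^a·σ₁ J → 0` for every `a`: for every height `J`, the descended Gibbs measure of run `J+1` RESTRICTED TO THE MODERATE BAD HISTORIES
(`V ∉ histGood_{J+1,J}` — given the window datum this says some run-`(J+1)` plaquette is `≥ θ_{J+1}` — but every plaquette `< δ₀`), further restricted to the
window `W_J = {PlaqSmall θ_J}`, is `≤ σ₁(J)` times the descended Gibbs measure restricted to the GOOD histories, on `W_J`.  Print's mechanism: Laplace
asymptotics on the fibre around the regular minimiser — the moderate region lies inside one chart where `A − A_min ≥ c·dist²` ([Balaban1985UV3] Thm 2 p.263,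
(38)–(41) p.266); a plaquette `≥ θ_{J+1}` forces `dist ≥ θ_{J+1}∕2` because the minimiser's own fine plaquettes are `≲ L^{−2}θ_J ≪ θ_{J+1}` up to the
window's edge ([Balaban1985Variational]); Gaussian tail `e^{−cβ_{J+1}θ²_{J+1}} = e^{−c p₀(g_{J+1})²}` against `N_{J+1} = 3(L^{m+J+1})³` plaquettes, and the
denominator bounded BELOW by the same Laplace expansion (Gaussian proxy: the NeumannFRD covariance `(Δ_N + Q_bᵀQ_b)⁻¹`, crux idea #158).
SHARED INPUT, IMPORTED NOT RE-PROVED (idea-crit-5 #387 P2, v1.1): that Laplace LOWER bound for the GOOD fibre integral with the same Gaussian normalisation IS the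
DEPTH-ONE UNIFORM FIBRE GAP — the registered organ row GAP♯ `UniformFibreGapOrbit` (`stub_uniformFibreGapOrbit` of the registry of record
`Lines/semiclassical_s2beta.lean` v11.2a b379df9b, RECORD 17bh) read at `K = J + 1`; a hand proving MOD₁ takes GAP♯'s depth-one instance as a hypothesis∕landed
theorem and must not re-derive it here.
WHY IT MIGHT FAIL: uniformity in the window datum up to the window's EDGE (`|F_P(U)| → θ_J`) needs the window-edge forcing constant `c_var < L^{3/2}p₀(g_{J+1})∕p₀(g_J)`
(LINE g21-1 falsifier (a)); and the RELATIVE form needs a Laplace LOWER bound for the good fibre integral with the same Gaussian normalisation — both are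
one-step statements but the lower bound through the `1_{hist}` cut-off at `θ_{J+1}` requires `θ_{J+1} ≫ g_{J+1}` (true: `p₀(g) → ∞`).
[cite: Balaban1985UV3, Thm 2 p.263 and (38)-(41) p.266; Balaban1985Averaging, (10) p.19; Balaban1985Variational, Thm 1] -/
def ModerateFieldOddsDepthOneCan : Prop :=
  ∀ (L : ℕ), ∃ pS : ℝ, ∀ (b₀ p₀ : ℝ), 0 < b₀ → pS ≤ p₀ → 0 < p₀ →
    ∃ δ₀ : ℝ, 0 < δ₀ ∧ ∃ γ₁ : ℝ, 0 < γ₁ ∧ ∀ (F : T3Family) (γ : ℝ), F.L = L → 0 < γ → γ ≤ γ₁ →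
      ∃ σ : ℕ → ℝ, (∀ J, 0 ≤ σ J) ∧ (∀ a : ℕ, Tendsto (fun J : ℕ => ((J : ℝ) + 1) ^ a * σ J) atTop (𝓝 0)) ∧
        ∀ J : ℕ,
          (Measure.map (descendTo F ℰp J (J + 1) (Nat.le_succ J))
              ((gibbsK F ℰp γ (J + 1)).restrict
                ((histGood F ℰp (θBal F.L γ b₀ p₀) (J + 1) J)ᶜ ∩
                  {V : GaugeField (F.P (J + 1)) 0 (Matrix.specialUnitaryGroup (Fin 2) ℂ) | PlaqSmall δ₀ V}))).restrict
              {U : GaugeField (F.P J) 0 (Matrix.specialUnitaryGroup (Fin 2) ℂ) | PlaqSmall (θBal F.L γ b₀ p₀ J) U} ≤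
            ENNReal.ofReal (σ J) •
              (Measure.map (descendTo F ℰp J (J + 1) (Nat.le_succ J))
                  ((gibbsK F ℰp γ (J + 1)).restrict (histGood F ℰp (θBal F.L γ b₀ p₀) (J + 1) J))).restrict
                {U : GaugeField (F.P J) 0 (Matrix.specialUnitaryGroup (Fin 2) ℂ) | PlaqSmall (θBal F.L γ b₀ p₀ J) U}

/-- **FAR₁ · FAR LARGE FIELDS COST ACTION: A PLAQUETTE OF SIZE `≥ δ₀` IS AN `e^{−c(δ₀)∕g²}`-FRACTION OF THE GOOD HISTORIES, FIBREWISE** (`FarFieldOddsDepthOneCan`;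
size M–L; NEW).  For every block size there is a profile threshold such that for every admissible profile and EVERY `δ₀ > 0` there is a coupling threshold
`γ₁(δ₀)` (small enough that `θ_j(γ) < δ₀` at all levels, so a `δ₀`-plaquette is a genuinely large field) and a modulus `σ₂ ≥ 0`, `(J+1)^a·σ₂ J → 0` for every
`a`, with: for every height `J`, the descended Gibbs measure of run `J+1` restricted to `{V | ¬PlaqSmall δ₀ V}` (SOME fine plaquette at distance `≥ δ₀` from `1`),
further restricted to the window `W_J`, is `≤ σ₂(J)` times the descended Gibbs measure restricted to the good histories, on `W_J`.  Print's mechanism: the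
Wilson action is a sum of non-negative plaquette terms, a `δ₀`-plaquette contributes `≥ c δ₀²·β_{J+1} = c δ₀²∕g²_{J+1}` MORE than its value near the minimiser,
and removing one plaquette term from the fibre Gibbs weight changes the good fibre integral by a bounded factor (the plaquette's links stay controlled by their
other plaquettes and the block constraint) — a Peierls∕chessboard-free RELATIVE bound `σ₂(J) ≍ N_{J+1}·e^{−cδ₀²∕g²_{J+1}}`, super-polynomial in `J` since
`g²_{J+1} ≍ γL^{−(J+1)}` ([Balaban1985UV3] (7) p.257: the large-field terms of the decomposition of unity carry `exp(−O(1)p₀(g)²)` at least; here the cruder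
`exp(−O(1)∕g²)` regime).  WHY IT MIGHT FAIL: the «remove the bad plaquette» comparison must be done ON THE CONSTRAINED FIBRE `{avg V = U}` uniformly in `U ∈ W_J`
and in the volume; a hand may find the block-average constraint couples the bad plaquette's links to a whole block, costing a factor `e^{O(L³)}` per removed
plaquette — harmless against `e^{−cδ₀²∕g²}` only while `g²_{J+1}·L³ ≪ δ₀²`, i.e. for `γ ≤ γ₁(δ₀, L)` (allowed by the quantifier order, but the constant must
not depend on `J` through anything but `g_{J+1}`).
[cite: Balaban1985UV3, (7) p.257 and (38)-(41) p.266; Balaban1989LargeFieldII, (1.95) p.389] -/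
def FarFieldOddsDepthOneCan : Prop :=
  ∀ (L : ℕ), ∃ pS : ℝ, ∀ (b₀ p₀ : ℝ), 0 < b₀ → pS ≤ p₀ → 0 < p₀ →
    ∀ δ₀ : ℝ, 0 < δ₀ → ∃ γ₁ : ℝ, 0 < γ₁ ∧ ∀ (F : T3Family) (γ : ℝ), F.L = L → 0 < γ → γ ≤ γ₁ →
      ∃ σ : ℕ → ℝ, (∀ J, 0 ≤ σ J) ∧ (∀ a : ℕ, Tendsto (fun J : ℕ => ((J : ℝ) + 1) ^ a * σ J) atTop (𝓝 0)) ∧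
        ∀ J : ℕ,
          (Measure.map (descendTo F ℰp J (J + 1) (Nat.le_succ J))
              ((gibbsK F ℰp γ (J + 1)).restrict
                {V : GaugeField (F.P (J + 1)) 0 (Matrix.specialUnitaryGroup (Fin 2) ℂ) | ¬ PlaqSmall δ₀ V})).restrict
              {U : GaugeField (F.P J) 0 (Matrix.specialUnitaryGroup (Fin 2) ℂ) | PlaqSmall (θBal F.L γ b₀ p₀ J) U} ≤
            ENNReal.ofReal (σ J) •
              (Measure.map (descendTo F ℰp J (J + 1) (Nat.le_succ J))
                  ((gibbsK F ℰp γ (J + 1)).restrict (histGood F ℰp (θBal F.L γ b₀ p₀) (J + 1) J))).restrict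
                {U : GaugeField (F.P J) 0 (Matrix.specialUnitaryGroup (Fin 2) ℂ) | PlaqSmall (θBal F.L γ b₀ p₀ J) U}

/-! ## §3 Tools: pointwise from a.e. for functions continuous on an open set; the super-polynomial class is closed under `log (1 + ·)` -/

section Tools

variable {α : Type*} [TopologicalSpace α] [MeasurableSpace α] [OpensMeasurableSpace α] {μ : Measure α} [μ.IsOpenPosMeasure]

/-- **POINTWISE FROM A.E.**: two functions continuous on an open set `U`, `f ≤ g` a.e. on `U` for an open-positive measure ⇒ `f ≤ g` at EVERY point of `U`
(the bad set is open and null, hence empty; px16's `canonVersion_le_of_ae_le_on` with the canonical versions replaced by any continuous pair). [folklore] -/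
theorem le_of_ae_le_of_continuousOn {f g : α → ℝ} {U : Set α} (hU : IsOpen U) (hf : ContinuousOn f U) (hg : ContinuousOn g U)
    (hle : ∀ᵐ y ∂μ.restrict U, f y ≤ g y) {x : α} (hx : x ∈ U) : f x ≤ g x := by
  have hVo : IsOpen (U ∩ (fun y => f y - g y) ⁻¹' Ioi 0) := (hf.sub hg).isOpen_inter_preimage hU isOpen_Ioi
  have hVnull : μ (U ∩ (fun y => f y - g y) ⁻¹' Ioi 0) = 0 := by
    have h' : ∀ᵐ y ∂μ, y ∈ U → f y ≤ g y := (ae_restrict_iff' hU.measurableSet).mp hle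
    rw [ae_iff] at h'
    refine measure_mono_null (fun y hy => ?_) h'
    obtain ⟨hyU, hy⟩ := hy
    have hy' : 0 < f y - g y := hy
    exact fun himp => absurd (himp hyU) (not_le.mpr (by linarith))
  have hVempty : U ∩ (fun y => f y - g y) ⁻¹' Ioi 0 = ∅ := (hVo.measure_eq_zero_iff μ).mp hVnull
  by_contra hlt
  have hxV : x ∈ U ∩ (fun y => f y - g y) ⁻¹' Ioi 0 := ⟨hx, by
    show 0 < f x - g x
    linarith [not_le.mp hlt]⟩
  rw [hVempty] at hxV
  exact hxV

end Tools

/-- `log (1 + s₁ + s₂) ≤ s₁ + s₂` for `s₁, s₂ ≥ 0`. [folklore] -/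
theorem log_one_add_add_le {s₁ s₂ : ℝ} (h₁ : 0 ≤ s₁) (h₂ : 0 ≤ s₂) : Real.log (1 + s₁ + s₂) ≤ s₁ + s₂ := by
  have := Real.log_le_sub_one_of_pos (show 0 < 1 + s₁ + s₂ by linarith)
  linarith

/-- The super-polynomial class is closed under `s ↦ log (1 + s₁ + s₂)`. [folklore] -/
theorem tendsto_pow_mul_log_one_add_add {σ₁ σ₂ : ℕ → ℝ} (h₁ : ∀ J, 0 ≤ σ₁ J) (h₂ : ∀ J, 0 ≤ σ₂ J)
    (t₁ : ∀ a : ℕ, Tendsto (fun J : ℕ => ((J : ℝ) + 1) ^ a * σ₁ J) atTop (𝓝 0))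
    (t₂ : ∀ a : ℕ, Tendsto (fun J : ℕ => ((J : ℝ) + 1) ^ a * σ₂ J) atTop (𝓝 0)) (a : ℕ) :
    Tendsto (fun J : ℕ => ((J : ℝ) + 1) ^ a * Real.log (1 + σ₁ J + σ₂ J)) atTop (𝓝 0) := by
  have hsum : Tendsto (fun J : ℕ => ((J : ℝ) + 1) ^ a * σ₁ J + ((J : ℝ) + 1) ^ a * σ₂ J) atTop (𝓝 0) := by
    simpa using (t₁ a).add (t₂ a)
  refine squeeze_zero (fun J => mul_nonneg (by positivity) (Real.log_nonneg (by linarith [h₁ J, h₂ J]))) (fun J => ?_) hsum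
  calc ((J : ℝ) + 1) ^ a * Real.log (1 + σ₁ J + σ₂ J) ≤ ((J : ℝ) + 1) ^ a * (σ₁ J + σ₂ J) :=
        mul_le_mul_of_nonneg_left (log_one_add_add_le (h₁ J) (h₂ J)) (by positivity)
    _ = ((J : ℝ) + 1) ^ a * σ₁ J + ((J : ℝ) + 1) ^ a * σ₂ J := by ring

/-! ## §4 PROVED: MOD₁ → FAR₁ → TAILSUP₁ (measure split + `withDensity` presentation + a.e.-to-pointwise upgrade on the open window) -/

/-- The implication this line certifies, as ONE named proposition (so that `windowOddsSupDepthOneCan_of_stubs` is the UNIQUE theorem concluding the target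
by name; PUBLISHED, not registered — RULING №36 (3)). -/
def SplitOneSuffices : Prop := ModerateFieldOddsDepthOneCan → FarFieldOddsDepthOneCan → WindowOddsSupDepthOneCan

/-- **COMPOSITION (PROVED)**. Thresholds: `pS := max`, `δ₀` from MOD₁, `γ₁ := min (γ₁ᴹ, γ₁ꜰ(δ₀), γ₁ᵂ)` with WREG's ✓`windowRegularity`; `τ J := log (1 + σ₁ J + σ₂ J)`.
Per `(ν, J, ρ)`: `ν_{J+1,J} = D_* Gibbs_{J+1}` (✓`tower_eq_map_descendTo`); `univ ⊆ hist ∪ E_mod ∪ E_far` ⇒ `D_*G|W ≤ (1+σ₁+σ₂)·D_*(G|hist)|W`; `withDensity`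
presentation ⇒ `heightDensity^{univ} ≤ (1+σ₁+σ₂)·heightDensity^{hist}` a.e. on `W` and `heightDensity^{hist} ≤ heightDensity^{univ}` a.e.; canonical versions
continuous on `W` (WREG ✓, VERS-mechanism ✓) ⇒ pointwise; `q^{univ}_can = Z·ρ` on `W` ⇒ `c := −log Z`.
[cite: Balaban1985UV3, (2) p.256 and (6)-(7) p.257; Balaban1987RG1, (0.13) p.254] -/
theorem windowOddsSupDepthOne_of_split : SplitOneSuffices := by
  intro hM hF L
  obtain ⟨pS₁, HM⟩ := hM L
  obtain ⟨pS₂, HF⟩ := hF L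
  refine ⟨max pS₁ pS₂, fun b₀ p₀ hb hpS hp => ?_⟩
  obtain ⟨δ₀, hδ₀, γM, hγM, HM⟩ := HM b₀ p₀ hb ((le_max_left _ _).trans hpS) hp
  obtain ⟨γF, hγF, HF⟩ := HF b₀ p₀ hb ((le_max_right _ _).trans hpS) hp δ₀ hδ₀
  obtain ⟨γW, hγW, HW⟩ := windowRegularity L b₀ p₀ hb hp
  refine ⟨min γM (min γF γW), lt_min hγM (lt_min hγF hγW), fun F γ hFL hγ hγle => ?_⟩
  obtain ⟨σ₁, hσ₁0, hσ₁t, HM⟩ := HM F γ hFL hγ (hγle.trans (min_le_left _ _))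
  obtain ⟨σ₂, hσ₂0, hσ₂t, HF⟩ := HF F γ hFL hγ (hγle.trans ((min_le_right _ _).trans (min_le_left _ _)))
  have HW' := HW F γ hFL hγ (hγle.trans ((min_le_right _ _).trans (min_le_right _ _)))
  refine ⟨fun J => Real.log (1 + σ₁ J + σ₂ J), fun J => Real.log_nonneg (by linarith [hσ₁0 J, hσ₂0 J]),
    tendsto_pow_mul_log_one_add_add hσ₁0 hσ₂0 hσ₁t hσ₂t, ?_⟩
  intro ν hνK hνd J ρ hρpos hνρ hρcont hgpos
  -- the standing objects at height `J`, run `J + 1`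
  haveI := B12ContinuousTransportInvariance.isOpenPosMeasure_fieldMeasure_SU (N := 2) (F.P J) 0
  set μ := fieldMeasure (F.P J) 0 (Matrix.specialUnitaryGroup (Fin 2) ℂ) with hμ
  set W : Set (GaugeField (F.P J) 0 (Matrix.specialUnitaryGroup (Fin 2) ℂ)) := {U | PlaqSmall (θBal F.L γ b₀ p₀ J) U} with hW
  set θ := θBal F.L γ b₀ p₀ with hθ
  set hist : Set (GaugeField (F.P (J + 1)) 0 (Matrix.specialUnitaryGroup (Fin 2) ℂ)) := histGood F ℰp θ (J + 1) J with hhist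
  set Emod : Set (GaugeField (F.P (J + 1)) 0 (Matrix.specialUnitaryGroup (Fin 2) ℂ)) := histᶜ ∩ {V | PlaqSmall δ₀ V} with hEmod
  set Efar : Set (GaugeField (F.P (J + 1)) 0 (Matrix.specialUnitaryGroup (Fin 2) ℂ)) := {V | ¬ PlaqSmall δ₀ V} with hEfar
  set G := gibbsK F ℰp γ (J + 1) with hG
  set D := descendTo F ℰp J (J + 1) (Nat.le_succ J) with hDdef
  set Z : ℝ := partitionFn (G := Matrix.specialUnitaryGroup (Fin 2) ℂ) (F.P (J + 1)) ((F.scheme ℰp γ).β (J + 1)) with hZ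
  have hZpos : 0 < Z := partitionFn_pos' _ (F.scheme_β_nonneg ℰp hγ.le (J + 1))
  have hWo : IsOpen W := isOpen_setOf_plaqSmall₂ (F.P J) 0 _
  have hWm : MeasurableSet W := hWo.measurableSet
  have hDm : Measurable D := measurable_descendTo F ℰp measurableE_ℰp _
  have hhistm : MeasurableSet hist := measurableSet_histGood F ℰp measurableE_ℰp θ (J + 1) J
  set hDu := heightDensity F γ (Nat.le_succ J) (Set.univ : Set (GaugeField (F.P (J + 1)) 0 (Matrix.specialUnitaryGroup (Fin 2) ℂ))) with hhDu
  set hDh := heightDensity F γ (Nat.le_succ J) hist with hhDh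
  obtain ⟨hDum, -⟩ := heightDensity_props F (Nat.le_succ J)
    (S := (Set.univ : Set (GaugeField (F.P (J + 1)) 0 (Matrix.specialUnitaryGroup (Fin 2) ℂ)))) MeasurableSet.univ hγ.le
  obtain ⟨hDhm, -⟩ := heightDensity_props F (Nat.le_succ J) (S := hist) hhistm hγ.le
  -- (1) the measure split: `D_* G |W ≤ (1 + σ₁ + σ₂) • D_*(G|hist) |W`
  have hM1 := HM J
  have hF1 := HF J
  have hsplit : G.restrict Set.univ ≤ G.restrict hist + G.restrict Emod + G.restrict Efar := by
    rw [Measure.le_iff]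
    intro s hs
    simp only [Measure.add_apply, Measure.restrict_apply hs, Set.inter_univ]
    calc G s ≤ G ((s ∩ hist ∪ s ∩ Emod) ∪ s ∩ Efar) := by
          refine measure_mono fun V hV => ?_
          by_cases h1 : V ∈ hist
          · exact Or.inl (Or.inl ⟨hV, h1⟩)
          · by_cases h2 : PlaqSmall δ₀ V
            · exact Or.inl (Or.inr ⟨hV, h1, h2⟩)
            · exact Or.inr ⟨hV, h2⟩
      _ ≤ G (s ∩ hist ∪ s ∩ Emod) + G (s ∩ Efar) := measure_union_le _ _
      _ ≤ G (s ∩ hist) + G (s ∩ Emod) + G (s ∩ Efar) := by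
          gcongr
          exact measure_union_le _ _
  have hmaple : Measure.map D (G.restrict Set.univ) ≤
      Measure.map D (G.restrict hist) + Measure.map D (G.restrict Emod) + Measure.map D (G.restrict Efar) := by
    have := Measure.map_mono hsplit hDm
    rwa [Measure.map_add _ _ hDm, Measure.map_add _ _ hDm] at this
  have hWle : (Measure.map D (G.restrict Set.univ)).restrict W ≤
      ENNReal.ofReal (1 + σ₁ J + σ₂ J) • (Measure.map D (G.restrict hist)).restrict W := by
    have h3 : (Measure.map D (G.restrict Set.univ)).restrict W ≤
        (Measure.map D (G.restrict hist)).restrict W + (Measure.map D (G.restrict Emod)).restrict W +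
          (Measure.map D (G.restrict Efar)).restrict W := by
      have := Measure.restrict_mono (s := W) (s' := W) le_rfl hmaple
      rwa [Measure.restrict_add, Measure.restrict_add] at this
    refine h3.trans ?_
    have hsum : ENNReal.ofReal (1 + σ₁ J + σ₂ J) = 1 + ENNReal.ofReal (σ₁ J) + ENNReal.ofReal (σ₂ J) := by
      rw [ENNReal.ofReal_add (by linarith [hσ₁0 J]) (hσ₂0 J), ENNReal.ofReal_add zero_le_one (hσ₁0 J), ENNReal.ofReal_one]
    rw [hsum, add_smul, add_smul, one_smul]
    gcongr
  -- (2) the `withDensity` presentation ⇒ a.e. inequalities of the height densities on `W`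
  have eU : Measure.map D (G.restrict Set.univ) = μ.withDensity (fun U => ENNReal.ofReal (Z⁻¹ * hDu U)) :=
    map_descendTo_restrict_eq_withDensity F (Nat.le_succ J) MeasurableSet.univ hγ.le
  have eH : Measure.map D (G.restrict hist) = μ.withDensity (fun U => ENNReal.ofReal (Z⁻¹ * hDh U)) :=
    map_descendTo_restrict_eq_withDensity F (Nat.le_succ J) hhistm hγ.le
  have hfu_m : Measurable (fun U => ENNReal.ofReal (Z⁻¹ * hDu U)) := (hDum.const_mul _).ennreal_ofReal
  have hfh_m : Measurable (fun U => ENNReal.ofReal (Z⁻¹ * hDh U)) := (hDhm.const_mul _).ennreal_ofReal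
  have hWle' : (μ.restrict W).withDensity (fun U => ENNReal.ofReal (Z⁻¹ * hDu U)) ≤
      (μ.restrict W).withDensity (fun U => ENNReal.ofReal (1 + σ₁ J + σ₂ J) * ENNReal.ofReal (Z⁻¹ * hDh U)) := by
    have h := hWle
    rw [eU, eH, restrict_withDensity hWm, restrict_withDensity hWm] at h
    refine h.trans (le_of_eq ?_)
    rw [← withDensity_smul _ hfh_m]
    rfl
  have hae1 : (fun U => ENNReal.ofReal (Z⁻¹ * hDu U)) ≤ᵐ[μ.restrict W]
      fun U => ENNReal.ofReal (1 + σ₁ J + σ₂ J) * ENNReal.ofReal (Z⁻¹ * hDh U) := by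
    refine ae_le_of_forall_setLIntegral_le_of_sigmaFinite hfu_m fun s hs _ => ?_
    rw [← withDensity_apply _ hs, ← withDensity_apply _ hs]
    exact Measure.le_iff'.1 hWle' s
  have hae1' : ∀ᵐ U ∂μ.restrict W, hDu U ≤ (1 + σ₁ J + σ₂ J) * hDh U := by
    filter_upwards [hae1] with U hU
    have hs0 : 0 ≤ 1 + σ₁ J + σ₂ J := by linarith [hσ₁0 J, hσ₂0 J]
    rw [← ENNReal.ofReal_mul hs0] at hU
    have hU' := (ENNReal.ofReal_le_ofReal_iff (mul_nonneg hs0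
      (mul_nonneg (inv_nonneg.mpr hZpos.le) (heightDensity_nonneg F γ _ _ U)))).mp hU
    have hZi : 0 < Z⁻¹ := inv_pos.mpr hZpos
    nlinarith [hU', heightDensity_nonneg F γ (Nat.le_succ J) hist U, heightDensity_nonneg F γ (Nat.le_succ J) Set.univ U]
  have hae2 : hDh ≤ᵐ[μ] hDu := heightDensity_mono_ae F (Nat.le_succ J) hhistm MeasurableSet.univ (subset_univ _) hγ.le
  -- (3) the canonical versions are continuous on the open window: WREG (hist) and the version `ρ` (univ)
  obtain ⟨hWregH, -⟩ := HW' J (J + 1) (Nat.le_succ J) γ hγ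
  obtain ⟨hWregU, hEqU⟩ := subset_regSet_heightDensity_univ_of_version F b₀ p₀ hγ ν hνK hνd (Nat.le_succ J) ρ hρpos hνρ hρcont
  set Qu := heightDensityCan F γ (Nat.le_succ J) (Set.univ : Set (GaugeField (F.P (J + 1)) 0 (Matrix.specialUnitaryGroup (Fin 2) ℂ))) with hQu
  set Qh := heightDensityCan F γ (Nat.le_succ J) hist with hQh
  have hQu_cont : ContinuousOn Qu W := Node00.continuousOn_canonVersion.mono hWregU
  have hQh_cont : ContinuousOn Qh W := Node00.continuousOn_canonVersion.mono hWregH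
  have hQuZ : ∀ U ∈ W, Qu U = Z * ρ U := fun U hU => hEqU hU
  -- (4) pointwise on `W`
  have hup : ∀ U ∈ W, Qu U ≤ (1 + σ₁ J + σ₂ J) * Qh U := by
    intro U hU
    refine le_of_ae_le_of_continuousOn (μ := μ) hWo hQu_cont (continuousOn_const.mul hQh_cont) ?_ hU
    filter_upwards [hae1', ae_restrict_of_ae (Node00.canonVersion_ae_eq (μ := μ) (f := hDu)),
      ae_restrict_of_ae (Node00.canonVersion_ae_eq (μ := μ) (f := hDh))] with V h1 h2 h3
    show Node00.canonVersion μ hDu V ≤ (1 + σ₁ J + σ₂ J) * Node00.canonVersion μ hDh V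
    rw [h2, h3]
    exact h1
  have hlow : ∀ U ∈ W, Qh U ≤ Qu U := fun U hU =>
    canonVersion_le_of_ae_le_on hWo hWregH hWregU (ae_restrict_of_ae hae2) hU
  -- (5) the odds
  refine ⟨-Real.log Z, fun U hU => ?_⟩
  have hUW : U ∈ W := hU
  have hQh_pos : 0 < Qh U := hgpos U hU
  have hρU : 0 < ρ U := hρpos U hU
  have hQu_pos : 0 < Qu U := by rw [hQuZ U hUW]; exact mul_pos hZpos hρU
  have hlogρ : Real.log (ρ U) = Real.log (Qu U) - Real.log Z := by
    rw [hQuZ U hUW, Real.log_mul hZpos.ne' hρU.ne']; ring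
  have hs0 : 0 < 1 + σ₁ J + σ₂ J := by linarith [hσ₁0 J, hσ₂0 J]
  have e : Real.log (ρ U) - -Real.log Z - Real.log (Qh U) = Real.log (Qu U) - Real.log (Qh U) := by rw [hlogρ]; ring
  refine ⟨?_, ?_⟩
  · show 0 ≤ Real.log (ρ U) - -Real.log Z - Real.log (Qh U)
    rw [e, sub_nonneg]
    exact Real.log_le_log hQh_pos (hlow U hUW)
  · show Real.log (ρ U) - -Real.log Z - Real.log (Qh U) ≤ Real.log (1 + σ₁ J + σ₂ J)
    rw [e, sub_le_iff_le_add, ← Real.log_mul hs0.ne' hQh_pos.ne']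
    exact Real.log_le_log hQu_pos (hup U hUW)

/-! ## §4c (v1.2) THE DOOR TO THE LEAD's PORT, PROVED: MOD₁ → FAR₁ → ⟨COND-ODDS₁⟩ (setwise conditional odds; union bound) — and TAILSUP₁ again through ✓p754917 -/

section CondOdds

/-- **⟨COND-ODDS₁⟩ · THE LEAD's SETWISE CONDITIONAL-ODDS ROW AT DEPTH ONE** — the hypothesis `h` of ✓`Summit.QuantumFields.YangMills.Theorems.
FluctuationComparisonRegPrIntLSupTailReduction.windowOddsSupDepthOneCan_of_condGoodOddsDepthOne` (ym-ust-20520-w3 g17, p754917), copied BYTE-FOR-BYTE: for every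
measurable `B` inside the window, `Gibbs_{J+1}(D⁻¹B) ≤ e^{τ J}·Gibbs_{J+1}(D⁻¹B ∩ histGood (J+1) J)`, `τ` super-polynomial.  MOD₁ ∧ FAR₁ give it by the union
bound over the cover `univ ⊆ hist ∪ (histᶜ ∩ {PlaqSmall δ₀}) ∪ {¬PlaqSmall δ₀}` with `e^{τ J} := 1 + σ₁ J + σ₂ J` (`condGoodOddsDepthOne_of_split` below).
[cite: Balaban1985UV3, (38)-(40) p.266; Balaban1985Averaging, (10) p.19] -/
def CondGoodOddsDepthOneCan : Prop :=
  ∀ (L : ℕ), ∃ pS : ℝ, ∀ (b₀ p₀ : ℝ), 0 < b₀ → pS ≤ p₀ → 0 < p₀ →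
        ∃ γ₁ : ℝ, 0 < γ₁ ∧ ∀ (F : T3Family) (γ : ℝ), F.L = L → 0 < γ → γ ≤ γ₁ →
          ∃ τ : ℕ → ℝ, (∀ J, 0 ≤ τ J) ∧ (∀ a : ℕ, Tendsto (fun J : ℕ => ((J : ℝ) + 1) ^ a * τ J) atTop (𝓝 0)) ∧
            ∀ (J : ℕ) (B : Set (GaugeField (F.P J) 0 (Matrix.specialUnitaryGroup (Fin 2) ℂ))), MeasurableSet B →
              B ⊆ {U | PlaqSmall (θBal F.L γ b₀ p₀ J) U} →
              gibbsK F ℰp γ (J + 1) (descendTo F ℰp J (J + 1) (Nat.le_succ J) ⁻¹' B) ≤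
                ENNReal.ofReal (Real.exp (τ J)) *
                  gibbsK F ℰp γ (J + 1) (descendTo F ℰp J (J + 1) (Nat.le_succ J) ⁻¹' B ∩ histGood F ℰp (θBal F.L γ b₀ p₀) (J + 1) J)

/-- ★ **MOD₁ → FAR₁ → ⟨COND-ODDS₁⟩** (PROVED; the measure split of §4 evaluated on a measurable `B ⊆ W_J`). -/
theorem condGoodOddsDepthOne_of_split (hM : ModerateFieldOddsDepthOneCan) (hF : FarFieldOddsDepthOneCan) :
    CondGoodOddsDepthOneCan := by
  intro L
  obtain ⟨pS₁, HM⟩ := hM L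
  obtain ⟨pS₂, HF⟩ := hF L
  refine ⟨max pS₁ pS₂, fun b₀ p₀ hb hpS hp => ?_⟩
  obtain ⟨δ₀, hδ₀, γM, hγM, HM⟩ := HM b₀ p₀ hb ((le_max_left _ _).trans hpS) hp
  obtain ⟨γF, hγF, HF⟩ := HF b₀ p₀ hb ((le_max_right _ _).trans hpS) hp δ₀ hδ₀
  refine ⟨min γM γF, lt_min hγM hγF, fun F γ hFL hγ hγle => ?_⟩
  obtain ⟨σ₁, hσ₁0, hσ₁t, HM⟩ := HM F γ hFL hγ (hγle.trans (min_le_left _ _))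
  obtain ⟨σ₂, hσ₂0, hσ₂t, HF⟩ := HF F γ hFL hγ (hγle.trans (min_le_right _ _))
  refine ⟨fun J => Real.log (1 + σ₁ J + σ₂ J), fun J => Real.log_nonneg (by linarith [hσ₁0 J, hσ₂0 J]),
    tendsto_pow_mul_log_one_add_add hσ₁0 hσ₂0 hσ₁t hσ₂t, ?_⟩
  intro J B hBm hBW
  set W : Set (GaugeField (F.P J) 0 (Matrix.specialUnitaryGroup (Fin 2) ℂ)) := {U | PlaqSmall (θBal F.L γ b₀ p₀ J) U} with hW
  set θ := θBal F.L γ b₀ p₀ with hθ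
  set hist : Set (GaugeField (F.P (J + 1)) 0 (Matrix.specialUnitaryGroup (Fin 2) ℂ)) := histGood F ℰp θ (J + 1) J with hhist
  set Emod : Set (GaugeField (F.P (J + 1)) 0 (Matrix.specialUnitaryGroup (Fin 2) ℂ)) := histᶜ ∩ {V | PlaqSmall δ₀ V} with hEmod
  set Efar : Set (GaugeField (F.P (J + 1)) 0 (Matrix.specialUnitaryGroup (Fin 2) ℂ)) := {V | ¬ PlaqSmall δ₀ V} with hEfar
  set G := gibbsK F ℰp γ (J + 1) with hG
  set D := descendTo F ℰp J (J + 1) (Nat.le_succ J) with hDdef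
  have hDm : Measurable D := measurable_descendTo F ℰp measurableE_ℰp _
  have hM1 := HM J
  have hF1 := HF J
  have hsplit : G.restrict Set.univ ≤ G.restrict hist + G.restrict Emod + G.restrict Efar := by
    rw [Measure.le_iff]
    intro s hs
    simp only [Measure.add_apply, Measure.restrict_apply hs, Set.inter_univ]
    calc G s ≤ G ((s ∩ hist ∪ s ∩ Emod) ∪ s ∩ Efar) := by
          refine measure_mono fun V hV => ?_
          by_cases h1 : V ∈ hist
          · exact Or.inl (Or.inl ⟨hV, h1⟩)
          · by_cases h2 : PlaqSmall δ₀ V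
            · exact Or.inl (Or.inr ⟨hV, h1, h2⟩)
            · exact Or.inr ⟨hV, h2⟩
      _ ≤ G (s ∩ hist ∪ s ∩ Emod) + G (s ∩ Efar) := measure_union_le _ _
      _ ≤ G (s ∩ hist) + G (s ∩ Emod) + G (s ∩ Efar) := by
          gcongr
          exact measure_union_le _ _
  have hmaple : Measure.map D (G.restrict Set.univ) ≤
      Measure.map D (G.restrict hist) + Measure.map D (G.restrict Emod) + Measure.map D (G.restrict Efar) := by
    have := Measure.map_mono hsplit hDm
    rwa [Measure.map_add _ _ hDm, Measure.map_add _ _ hDm] at this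
  have hWle : (Measure.map D (G.restrict Set.univ)).restrict W ≤
      ENNReal.ofReal (1 + σ₁ J + σ₂ J) • (Measure.map D (G.restrict hist)).restrict W := by
    have h3 : (Measure.map D (G.restrict Set.univ)).restrict W ≤
        (Measure.map D (G.restrict hist)).restrict W + (Measure.map D (G.restrict Emod)).restrict W +
          (Measure.map D (G.restrict Efar)).restrict W := by
      have := Measure.restrict_mono (s := W) (s' := W) le_rfl hmaple
      rwa [Measure.restrict_add, Measure.restrict_add] at this
    refine h3.trans ?_
    have hsum : ENNReal.ofReal (1 + σ₁ J + σ₂ J) = 1 + ENNReal.ofReal (σ₁ J) + ENNReal.ofReal (σ₂ J) := by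
      rw [ENNReal.ofReal_add (by linarith [hσ₁0 J]) (hσ₂0 J), ENNReal.ofReal_add zero_le_one (hσ₁0 J), ENNReal.ofReal_one]
    rw [hsum, add_smul, add_smul, one_smul]
    gcongr
  -- evaluate on `B ⊆ W`
  have hexp : Real.exp (Real.log (1 + σ₁ J + σ₂ J)) = 1 + σ₁ J + σ₂ J :=
    Real.exp_log (by linarith [hσ₁0 J, hσ₂0 J])
  have hBW' : B ∩ W = B := Set.inter_eq_left.mpr hBW
  have h1 : (Measure.map D (G.restrict Set.univ)).restrict W B = G (D ⁻¹' B) := by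
    rw [Measure.restrict_apply hBm, hBW', Measure.map_apply hDm hBm, Measure.restrict_apply (hDm hBm), Set.inter_univ]
  have h2 : (ENNReal.ofReal (1 + σ₁ J + σ₂ J) • (Measure.map D (G.restrict hist)).restrict W) B =
      ENNReal.ofReal (1 + σ₁ J + σ₂ J) * G (D ⁻¹' B ∩ hist) := by
    rw [Measure.smul_apply, smul_eq_mul, Measure.restrict_apply hBm, hBW', Measure.map_apply hDm hBm,
      Measure.restrict_apply (hDm hBm)]
  have h3 := (Measure.le_iff'.1 hWle) B
  rw [h1, h2] at h3
  rw [hexp]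
  exact h3

/-- ★ **TAILSUP₁ THROUGH THE LEAD's PORT** (a second, independent route by kernel: MOD₁ → FAR₁ → ⟨COND-ODDS₁⟩ → TAILSUP₁ via ✓p754917
`…SupTailReduction.windowOddsSupDepthOneCan_of_condGoodOddsDepthOne`; the port's conclusion is this file's `WindowOddsSupDepthOneCan` up to `δ`). -/
theorem windowOddsSupDepthOne_of_split_via_port : SplitOneSuffices := fun hM hF =>
  Summit.QuantumFields.YangMills.Theorems.FluctuationComparisonRegPrIntLSupTailReduction.windowOddsSupDepthOneCan_of_condGoodOddsDepthOne
    (condGoodOddsDepthOne_of_split hM hF)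

end CondOdds

/-! ## §4d (v1.3) THE PINNED-PLAQUETTE FORM OF THE ROWS (Bałaban's (38)–(41): one large plaquette at a time) AND THE PROVED UNION-BOUND DOORS
PPT → MOD₁, FPT → FAR₁, PPT → FPT → TAILSUP₁.  The hand's residual per row becomes ONE sentence about ONE fibre law and ONE plaquette. -/

section Pinned

/-- **GENERIC UNION BOUND UNDER PUSH-FORWARD AND WINDOW RESTRICTION** (pure measure theory): if on the window every point of `E` lies in some
`Es i` (`i` in a finite index type) and each pinned row holds with constant `c`, the row for `E` holds with constant `#ι · c`. [folklore] -/
theorem restrict_map_le_card_mul_smul_of_pinned {X Y : Type*} [MeasurableSpace X] [MeasurableSpace Y] {ι : Type*} [Fintype ι]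
    (G : Measure X) {D : X → Y} (hD : Measurable D) {W : Set Y} (hW : MeasurableSet W) (E : Set X) (Es : ι → Set X)
    (ν : Measure Y) (c : ℝ≥0∞)
    (hcov : ∀ V, D V ∈ W → V ∈ E → ∃ i, V ∈ Es i)
    (hrow : ∀ i, (Measure.map D (G.restrict (Es i))).restrict W ≤ c • ν) :
    (Measure.map D (G.restrict E)).restrict W ≤ ((Fintype.card ι : ℝ≥0∞) * c) • ν := by
  rw [Measure.le_iff]
  intro s hs
  rw [Measure.restrict_apply hs, Measure.map_apply hD (hs.inter hW), Measure.restrict_apply (hD (hs.inter hW)),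
    Measure.smul_apply, smul_eq_mul]
  calc G (D ⁻¹' (s ∩ W) ∩ E) ≤ G (⋃ i, D ⁻¹' (s ∩ W) ∩ Es i) := by
        refine measure_mono fun V hV => ?_
        obtain ⟨i, hi⟩ := hcov V hV.1.2 hV.2
        exact Set.mem_iUnion.mpr ⟨i, hV.1, hi⟩
    _ ≤ ∑ i, G (D ⁻¹' (s ∩ W) ∩ Es i) := measure_iUnion_fintype_le G _
    _ ≤ ∑ _i : ι, c * ν s := by
        refine Finset.sum_le_sum fun i _ => ?_
        have h := (Measure.le_iff.1 (hrow i)) s hs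
        rwa [Measure.restrict_apply hs, Measure.map_apply hD (hs.inter hW), Measure.restrict_apply (hD (hs.inter hW)),
          Measure.smul_apply, smul_eq_mul] at h
    _ = (Fintype.card ι : ℝ≥0∞) * c * ν s := by
        rw [Finset.sum_const, Finset.card_univ, nsmul_eq_mul, mul_assoc]

/-- **ON THE WINDOW, A BAD DEPTH-ONE HISTORY HAS A LARGE FINEST PLAQUETTE**: if the descended field is `θ_J`-small and `V ∉ histGood (J+1) J` then
`¬ PlaqSmall θ_{J+1} V` (event peeling `histGood_succ` + `descendTo_succ_eq` + `descendTo_self`; the height-`J` condition is the window). [cite: Balaban1985UV3, (7) p.257] -/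
theorem not_plaqSmall_of_not_mem_histGood_depthOne (F : T3Family) (θ : ℕ → ℝ) (J : ℕ)
    (V : GaugeField (F.P (J + 1)) 0 (Matrix.specialUnitaryGroup (Fin 2) ℂ))
    (hW : PlaqSmall (θ J) (descendTo F ℰp J (J + 1) (Nat.le_succ J) V))
    (hV : V ∉ histGood F ℰp θ (J + 1) J) : ¬ PlaqSmall (θ (J + 1)) V := by
  intro hsm
  apply hV
  rw [Summit.QuantumFields.YangMills.Theorems.LogComparisonOneTower.histGood_succ F J θ le_rfl]
  refine ⟨hsm, ?_⟩
  rw [Summit.QuantumFields.YangMills.Theorems.LogComparisonOneTower.descendTo_succ_eq (F := F) (K := J) (ℰ := ℰp) le_rfl V,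
    T3DescentFibreTower.descendTo_self] at hW
  simp only [Set.mem_preimage, histGood]
  intro j hj
  obtain rfl : j = 0 := by omega
  exact hW

/-- **PPT · PINNED MODERATE PLAQUETTE, DEPTH ONE** (`PinnedModerateOddsDepthOneCan`; the per-plaquette form of MOD₁ = [Balaban1985UV3] (38)–(41) one
plaquette at a time): quantifier prefix of MOD₁; then a modulus `σ ≥ 0` whose product with the NUMBER OF FINEST PLAQUETTES `#Plaq_{J+1}` is
super-polynomially small in `J` (the union bound's price is paid INSIDE the row — as the Gaussian proxy does: `2·e^{−m p₀(g_{J+1})²∕2R²}` per plaquette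
against `#Plaq_{J+1} ≍ 3(L^{m+J+1})³`), and for every height `J` and every finest plaquette `p` of run `J+1`: the descended Gibbs measure restricted to
`{θ_{J+1} ≤ |V(∂p) − 1|} ∩ {PlaqSmall δ₀ V}` (plaquette `p` moderately large, no plaquette far), on the window `W_J`, is `≤ σ(J)` times the descended
Gibbs measure restricted to the good histories, on `W_J`.  CONTENT: Laplace on the constrained fibre with ONE pinned plaquette — a single-functional
tail of the fibre law relative to the good mass; the naive global sandwich of the non-Gaussian action costs an EXTENSIVE factor `e^{O(δ₀²)·#links}` and is
useless, so the comparison must be LOCAL around `p` (small-field cluster expansion with one pinned plaquette, [Balaban1985UV3] §3; or a local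
log-Sobolev∕decoupling argument at scale `g_{J+1}`) — group-curvature concentration (scale `O(1)`, not `O(g)`) does NOT suffice.
WHY IT MIGHT FAIL: as MOD₁ (window-edge forcing `c_var < L^{3∕2}`, binding at `L = 3`); plus the locality step is a genuine piece of the
small-field expansion. [cite: Balaban1985UV3, (38)-(41) p.266; Balaban1985Variational, Thm 1 p.279] -/
def PinnedModerateOddsDepthOneCan : Prop :=
  ∀ (L : ℕ), ∃ pS : ℝ, ∀ (b₀ p₀ : ℝ), 0 < b₀ → pS ≤ p₀ → 0 < p₀ →
    ∃ δ₀ : ℝ, 0 < δ₀ ∧ ∃ γ₁ : ℝ, 0 < γ₁ ∧ ∀ (F : T3Family) (γ : ℝ), F.L = L → 0 < γ → γ ≤ γ₁ →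
      ∃ σ : ℕ → ℝ, (∀ J, 0 ≤ σ J) ∧
        (∀ a : ℕ, Tendsto (fun J : ℕ => ((J : ℝ) + 1) ^ a * ((Fintype.card (Plaq (F.P (J + 1)) 0) : ℝ) * σ J)) atTop (𝓝 0)) ∧
        ∀ (J : ℕ) (p : Plaq (F.P (J + 1)) 0),
          (Measure.map (descendTo F ℰp J (J + 1) (Nat.le_succ J))
              ((gibbsK F ℰp γ (J + 1)).restrict
                ({V : GaugeField (F.P (J + 1)) 0 (Matrix.specialUnitaryGroup (Fin 2) ℂ) |
                    θBal F.L γ b₀ p₀ (J + 1) ≤ dist1 (GaugeField.plaqHol V p)} ∩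
                  {V : GaugeField (F.P (J + 1)) 0 (Matrix.specialUnitaryGroup (Fin 2) ℂ) | PlaqSmall δ₀ V}))).restrict
              {U : GaugeField (F.P J) 0 (Matrix.specialUnitaryGroup (Fin 2) ℂ) | PlaqSmall (θBal F.L γ b₀ p₀ J) U} ≤
            ENNReal.ofReal (σ J) •
              (Measure.map (descendTo F ℰp J (J + 1) (Nat.le_succ J))
                  ((gibbsK F ℰp γ (J + 1)).restrict (histGood F ℰp (θBal F.L γ b₀ p₀) (J + 1) J))).restrict
                {U : GaugeField (F.P J) 0 (Matrix.specialUnitaryGroup (Fin 2) ℂ) | PlaqSmall (θBal F.L γ b₀ p₀ J) U}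

/-- **FPT · PINNED FAR PLAQUETTE, DEPTH ONE** (`PinnedFarOddsDepthOneCan`; the per-plaquette form of FAR₁): quantifier prefix of FAR₁ (`∀ δ₀ > 0`,
`γ₁` may depend on `δ₀`); modulus `σ ≥ 0` with `#Plaq_{J+1}·σ(J)` super-polynomial; for every `J` and every finest plaquette `p`: the descended Gibbs
measure restricted to `{δ₀ ≤ |V(∂p) − 1|}` (plaquette `p` FAR from `1`), on `W_J`, is `≤ σ(J)` times the good-history one.  CONTENT: the Peierls-type
RELATIVE action-cost bound for one pinned plaquette on the constrained fibre, `σ(J) ≍ e^{−cδ₀²∕g²_{J+1}}`.  WHY IT MIGHT FAIL: as FAR₁ (the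
block-average constraint couples `p`'s links to a block; cost `e^{O(L³)}` per pinned plaquette, absorbed by `γ₁(δ₀, L)`).
[cite: Balaban1985UV3, (7) p.257 and (38)-(41) p.266; Balaban1989LargeFieldII, (1.95) p.389] -/
def PinnedFarOddsDepthOneCan : Prop :=
  ∀ (L : ℕ), ∃ pS : ℝ, ∀ (b₀ p₀ : ℝ), 0 < b₀ → pS ≤ p₀ → 0 < p₀ →
    ∀ δ₀ : ℝ, 0 < δ₀ → ∃ γ₁ : ℝ, 0 < γ₁ ∧ ∀ (F : T3Family) (γ : ℝ), F.L = L → 0 < γ → γ ≤ γ₁ →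
      ∃ σ : ℕ → ℝ, (∀ J, 0 ≤ σ J) ∧
        (∀ a : ℕ, Tendsto (fun J : ℕ => ((J : ℝ) + 1) ^ a * ((Fintype.card (Plaq (F.P (J + 1)) 0) : ℝ) * σ J)) atTop (𝓝 0)) ∧
        ∀ (J : ℕ) (p : Plaq (F.P (J + 1)) 0),
          (Measure.map (descendTo F ℰp J (J + 1) (Nat.le_succ J))
              ((gibbsK F ℰp γ (J + 1)).restrict
                {V : GaugeField (F.P (J + 1)) 0 (Matrix.specialUnitaryGroup (Fin 2) ℂ) |
                    δ₀ ≤ dist1 (GaugeField.plaqHol V p)})).restrict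
              {U : GaugeField (F.P J) 0 (Matrix.specialUnitaryGroup (Fin 2) ℂ) | PlaqSmall (θBal F.L γ b₀ p₀ J) U} ≤
            ENNReal.ofReal (σ J) •
              (Measure.map (descendTo F ℰp J (J + 1) (Nat.le_succ J))
                  ((gibbsK F ℰp γ (J + 1)).restrict (histGood F ℰp (θBal F.L γ b₀ p₀) (J + 1) J))).restrict
                {U : GaugeField (F.P J) 0 (Matrix.specialUnitaryGroup (Fin 2) ℂ) | PlaqSmall (θBal F.L γ b₀ p₀ J) U}

/-- ★ **PPT → MOD₁** (PROVED: union bound over the finest plaquettes; on the window a bad depth-one history has a `θ_{J+1}`-large finest plaquette). -/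
theorem moderateFieldOdds_of_pinned (h : PinnedModerateOddsDepthOneCan) : ModerateFieldOddsDepthOneCan := by
  intro L
  obtain ⟨pS, H⟩ := h L
  refine ⟨pS, fun b₀ p₀ hb hpS hp => ?_⟩
  obtain ⟨δ₀, hδ₀, γ₁, hγ₁, H⟩ := H b₀ p₀ hb hpS hp
  refine ⟨δ₀, hδ₀, γ₁, hγ₁, fun F γ hFL hγ hγle => ?_⟩
  obtain ⟨σ, hσ0, hσt, H⟩ := H F γ hFL hγ hγle
  refine ⟨fun J => (Fintype.card (Plaq (F.P (J + 1)) 0) : ℝ) * σ J, fun J => mul_nonneg (Nat.cast_nonneg _) (hσ0 J), hσt,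
    fun J => ?_⟩
  have hDm : Measurable (descendTo F ℰp J (J + 1) (Nat.le_succ J)) := measurable_descendTo F ℰp measurableE_ℰp _
  have hWm : MeasurableSet {U : GaugeField (F.P J) 0 (Matrix.specialUnitaryGroup (Fin 2) ℂ) | PlaqSmall (θBal F.L γ b₀ p₀ J) U} :=
    (isOpen_setOf_plaqSmall₂ (F.P J) 0 _).measurableSet
  have hcov : ∀ V, descendTo F ℰp J (J + 1) (Nat.le_succ J) V ∈
      {U : GaugeField (F.P J) 0 (Matrix.specialUnitaryGroup (Fin 2) ℂ) | PlaqSmall (θBal F.L γ b₀ p₀ J) U} →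
      V ∈ (histGood F ℰp (θBal F.L γ b₀ p₀) (J + 1) J)ᶜ ∩
          {V : GaugeField (F.P (J + 1)) 0 (Matrix.specialUnitaryGroup (Fin 2) ℂ) | PlaqSmall δ₀ V} →
      ∃ p : Plaq (F.P (J + 1)) 0, V ∈
        {V : GaugeField (F.P (J + 1)) 0 (Matrix.specialUnitaryGroup (Fin 2) ℂ) |
            θBal F.L γ b₀ p₀ (J + 1) ≤ dist1 (GaugeField.plaqHol V p)} ∩
          {V : GaugeField (F.P (J + 1)) 0 (Matrix.specialUnitaryGroup (Fin 2) ℂ) | PlaqSmall δ₀ V} := by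
    intro V hVW hV
    have hns := not_plaqSmall_of_not_mem_histGood_depthOne F (θBal F.L γ b₀ p₀) J V hVW hV.1
    simp only [PlaqSmall, not_forall, not_lt] at hns
    obtain ⟨p, hp⟩ := hns
    exact ⟨p, hp, hV.2⟩
  have key := restrict_map_le_card_mul_smul_of_pinned (gibbsK F ℰp γ (J + 1)) hDm hWm _ _ _ (ENNReal.ofReal (σ J)) hcov
    (fun p => H J p)
  rw [ENNReal.ofReal_mul (Nat.cast_nonneg _), ENNReal.ofReal_natCast]
  exact key

/-- ★ **FPT → FAR₁** (PROVED: union bound over the finest plaquettes; `¬ PlaqSmall δ₀ V` means some plaquette is `δ₀`-far). -/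
theorem farFieldOdds_of_pinned (h : PinnedFarOddsDepthOneCan) : FarFieldOddsDepthOneCan := by
  intro L
  obtain ⟨pS, H⟩ := h L
  refine ⟨pS, fun b₀ p₀ hb hpS hp δ₀ hδ₀ => ?_⟩
  obtain ⟨γ₁, hγ₁, H⟩ := H b₀ p₀ hb hpS hp δ₀ hδ₀
  refine ⟨γ₁, hγ₁, fun F γ hFL hγ hγle => ?_⟩
  obtain ⟨σ, hσ0, hσt, H⟩ := H F γ hFL hγ hγle
  refine ⟨fun J => (Fintype.card (Plaq (F.P (J + 1)) 0) : ℝ) * σ J, fun J => mul_nonneg (Nat.cast_nonneg _) (hσ0 J), hσt,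
    fun J => ?_⟩
  have hDm : Measurable (descendTo F ℰp J (J + 1) (Nat.le_succ J)) := measurable_descendTo F ℰp measurableE_ℰp _
  have hWm : MeasurableSet {U : GaugeField (F.P J) 0 (Matrix.specialUnitaryGroup (Fin 2) ℂ) | PlaqSmall (θBal F.L γ b₀ p₀ J) U} :=
    (isOpen_setOf_plaqSmall₂ (F.P J) 0 _).measurableSet
  have hcov : ∀ V, descendTo F ℰp J (J + 1) (Nat.le_succ J) V ∈
      {U : GaugeField (F.P J) 0 (Matrix.specialUnitaryGroup (Fin 2) ℂ) | PlaqSmall (θBal F.L γ b₀ p₀ J) U} →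
      V ∈ {V : GaugeField (F.P (J + 1)) 0 (Matrix.specialUnitaryGroup (Fin 2) ℂ) | ¬ PlaqSmall δ₀ V} →
      ∃ p : Plaq (F.P (J + 1)) 0, V ∈
        {V : GaugeField (F.P (J + 1)) 0 (Matrix.specialUnitaryGroup (Fin 2) ℂ) | δ₀ ≤ dist1 (GaugeField.plaqHol V p)} := by
    intro V _ hV
    simp only [Set.mem_setOf_eq, PlaqSmall, not_forall, not_lt] at hV
    exact hV
  have key := restrict_map_le_card_mul_smul_of_pinned (gibbsK F ℰp γ (J + 1)) hDm hWm _ _ _ (ENNReal.ofReal (σ J)) hcov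
    (fun p => H J p)
  rw [ENNReal.ofReal_mul (Nat.cast_nonneg _), ENNReal.ofReal_natCast]
  exact key

/-- ★ **PPT → FPT → TAILSUP₁** (the two pinned rows suffice; composition with §4). -/
theorem windowOddsSupDepthOne_of_pinned (h₁ : PinnedModerateOddsDepthOneCan) (h₂ : PinnedFarOddsDepthOneCan) :
    WindowOddsSupDepthOneCan :=
  windowOddsSupDepthOne_of_split (moderateFieldOdds_of_pinned h₁) (farFieldOdds_of_pinned h₂)

end Pinned

/-! ## §4e (v1.4, after ROW «R3-FLIN» j337502) THE INTERIOR-WINDOW ROWS — the window profile `c·b₀` DECOUPLED from the history profile `b₀`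

R3-FLIN (instrument seat ym-r3-instr-1 g9, 2026-08-30T02:14Z; report `pub/ideators/ym-r3-idea-2/instr/JOBFL_report.md` b36fd88b; GUIDANCE, proves nothing)
measured the linearised one-step de-averaging amplification `c_lin(L,n) = L²·max_p sup{|(dA_min)_p| : ‖d̄V‖∞ ≤ 1}` and found `c_lin(3,4) ≥ 8.56 > 3^{3/2} = 5.20`
(certified lower bound of the large-volume constant): for STAGGERED window data at the window's EDGE the fibre minimiser's largest level-`(J+1)` plaquette is
`≈ 0.95·θ_J > θ_{J+1} = L^{-1/2}·(p(g_{J+1})∕p(g_J))·θ_J ≈ 0.58·θ_J` at `L = 3` — the BOUNDARY LAYER `BL_J := {U ∈ W_J(b₀) : V*(U) ∉ W_{J+1}(b₀)}` is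
non-empty, and on it `−log P(hist(b₀) ∣ V_J = U) ≍ c·L·p(g_J)²` while in the deep interior it is `≍ #Plaq·e^{−c p(g_{J+1})²} → 0`.  So every row whose
constant is UNIFORM OVER THE FULL WINDOW `W_J(b₀)` for a `hist(b₀)`-relative quantity — MOD₁, PPT, TAILSUP₁ (and TAILSUP, ⟨COND-ODDS₁⟩, the one-loop rows
LFR♯ᶜ ∕ H4ᶜ ∕ 1L4ᶜ(T)) — is EXPOSED AS TYPED at `L = 3` (toy-level: linearised, floating point; not a ledger refutation).  IMMUNE: FAR₁ ∕ FPT (their numerator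
`e^{−β_{J+1}δ₀²∕C}` beats the boundary-layer denominator), S2β (no history restriction), the crux 20520 (typed on the `c`-interior, `T3InteriorExcision`).
THE VARY (pen's rule A3): the rows below carry ONE window fraction `c = c(L) ∈ (0,1]` right after `∀ L` — the crux's own prefix — with the WINDOW at
`θBal F.L γ (c * b₀) p₀ J = c·θ_J(b₀)` (`T3InteriorExcision.θBal_mul`) and the HISTORY unchanged at `θBal F.L γ b₀ p₀`; price in the toy `c(L) <
L^{3/2}∕(π_J·sup_n c_lin(L,n))` (`< 0.61` at `L = 3` today), none for `L ≳ 7`.  The full-window rows stay on file (§1, §2, §4d) as the record the toy speaks to;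
the ∘-rows and the full-window rows are INCOMPARABLE as Props (the ∘-row's hypotheses shrink with its window; mathematically it is the weaker claim).
TYPING OF THE FRACTION (v1.5, ★★OWNER WORD 81 (3)(c)): ONE SHARED SHAPE per row, `∀ (L : ℕ), ∃ c₀ : ℝ, 0 < c₀ ∧ c₀ ≤ 1 ∧ ∀ (c : ℝ), 0 < c → c ≤ c₀ → ∃ pS, …`
(«for every sufficiently small window fraction»: rows are closed under shrinking `c` by fiat, and a concluder over several rows takes `c := min c₀ᵢ`) — NOT a
private `∃ c` per row. -/

section Interior

open T3InteriorExcision (θBal_mul_le)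
open T3PrintedMinimiserExistence (plaqSmall_of_le)

/-- The `c`-interior of the window lies in the window (`0 < γ ≤ 1`, `0 < b₀`, `c ≤ 1`, `1 < F.L`). [cite: Balaban1985UV3, (7) p.257] -/
theorem setOf_plaqSmall_interior_subset (F : T3Family) {γ b₀ c : ℝ} (hγ : 0 < γ) (hγ1 : γ ≤ 1) (hb : 0 < b₀) (hc1 : c ≤ 1)
    (p₀ : ℝ) (J : ℕ) :
    {U : GaugeField (F.P J) 0 (Matrix.specialUnitaryGroup (Fin 2) ℂ) | PlaqSmall (θBal F.L γ (c * b₀) p₀ J) U} ⊆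
      {U : GaugeField (F.P J) 0 (Matrix.specialUnitaryGroup (Fin 2) ℂ) | PlaqSmall (θBal F.L γ b₀ p₀ J) U} :=
  fun _ hU => plaqSmall_of_le (θBal_mul_le (le_of_lt F.hL.2) hγ hγ1 hb hc1 p₀ J) hU

/-- A setwise odds bound on a window restricts to any measurable sub-window. [folklore] -/
theorem restrict_le_smul_restrict_of_subset {X : Type*} [MeasurableSpace X] {A B : Measure X} {W W' : Set X} (hW'm : MeasurableSet W')
    (hsub : W' ⊆ W) {κ : ℝ≥0∞} (h : A.restrict W ≤ κ • B.restrict W) : A.restrict W' ≤ κ • B.restrict W' := by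
  have h' := Measure.restrict_mono (s := W') (s' := W') le_rfl h
  rwa [Measure.restrict_smul, Measure.restrict_restrict hW'm, Measure.restrict_restrict hW'm, Set.inter_eq_left.mpr hsub] at h'

/-- **TAILSUP₁∘ · THE FIRST RUNG ON THE INTERIOR WINDOW** (`WindowOddsSupDepthOneIntCan`; v1.4): TAILSUP₁ with ONE window fraction `c ∈ (0,1]` per block
size (`∀ L, ∃ c₀, 0 < c₀ ∧ c₀ ≤ 1 ∧ ∀ c, 0 < c → c ≤ c₀ → …` — «every sufficiently small fraction»; cf. the prefix `∀ L, ∃ c …` of the crux `FluctuationComparisonRegPrIntL`), every WINDOW clause read at `θBal F.L γ (c * b₀) p₀ J`, the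
HISTORY `histGood F ℰp (θBal F.L γ b₀ p₀) (J + 1) J` unchanged; the inner additive constant is renamed `a₀` (v1.5: the fraction has the SHARED SHAPE `∃ c₀, 0 < c₀ ∧ c₀ ≤ 1 ∧ ∀ c, 0 < c → c ≤ c₀ → …`).  Print's mechanism as TAILSUP₁, now applied
where it is valid: for `U` in the `c`-interior the fibre minimiser stays inside `W_{J+1}(b₀)` with margin (`c·C(L)∕L² < L^{-1/2}π_J`), so the Gaussian
tail × entropy estimate of [Balaban1985UV3] (38)–(40) is uniform in `U`.  WHY IT MIGHT FAIL: the admissible `c(L)` is priced by the NONLINEAR, large-volume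
amplification constant `C(L) = sup_n c_var(L,n)`, known today only as a linearised lower bound (8.56 at `L = 3`, not converged in `n`); if `C(3)` were
unbounded in the volume no `c(3) > 0` would do (ruled out heuristically by the exponential localisation D3, ℓ¹-tail ratios 0.2–0.3 per coarse step).
[cite: Balaban1985UV3, (38)-(40) p.266; Balaban1985Averaging, (10) p.19; King1986, Prop. 3.8-3.9 pp.664-665] -/
def WindowOddsSupDepthOneIntCan : Prop :=
  ∀ (L : ℕ), ∃ c₀ : ℝ, 0 < c₀ ∧ c₀ ≤ 1 ∧ ∀ (c : ℝ), 0 < c → c ≤ c₀ → ∃ pS : ℝ, ∀ (b₀ p₀ : ℝ), 0 < b₀ → pS ≤ p₀ → 0 < p₀ →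
    ∃ γ₁ : ℝ, 0 < γ₁ ∧ ∀ (F : T3Family) (γ : ℝ), F.L = L → 0 < γ → γ ≤ γ₁ →
      ∃ τ : ℕ → ℝ, (∀ J, 0 ≤ τ J) ∧ (∀ a : ℕ, Tendsto (fun J : ℕ => ((J : ℝ) + 1) ^ a * τ J) atTop (𝓝 0)) ∧
        ∀ (ν : ℕ → (j : ℕ) → Measure (GaugeField (F.P j) 0 (Matrix.specialUnitaryGroup (Fin 2) ℂ))),
          (∀ K, ν K K = T4GenFunBounds.gibbsMeasure (F.P K) ((F.scheme ℰp γ).β K)) →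
          (∀ K j, j < K → ν K j = Measure.map (descend F ℰp j) (ν K (j + 1))) →
          ∀ (J : ℕ) (ρ : GaugeField (F.P J) 0 (Matrix.specialUnitaryGroup (Fin 2) ℂ) → ℝ),
            (∀ U, PlaqSmall (θBal F.L γ (c * b₀) p₀ J) U → 0 < ρ U) →
            ν (J + 1) J = (fieldMeasure _ _ _).withDensity (fun U => ENNReal.ofReal (ρ U)) →
            ContinuousOn ρ {U | PlaqSmall (θBal F.L γ (c * b₀) p₀ J) U} →
            (∀ U : GaugeField (F.P J) 0 (Matrix.specialUnitaryGroup (Fin 2) ℂ), PlaqSmall (θBal F.L γ (c * b₀) p₀ J) U →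
                0 < heightDensityCan F γ (Nat.le_succ J) (histGood F ℰp (θBal F.L γ b₀ p₀) (J + 1) J) U) →
            ∃ a₀ : ℝ, ∀ U : GaugeField (F.P J) 0 (Matrix.specialUnitaryGroup (Fin 2) ℂ), PlaqSmall (θBal F.L γ (c * b₀) p₀ J) U →
              0 ≤ Real.log (ρ U) - a₀ - Real.log (heightDensityCan F γ (Nat.le_succ J) (histGood F ℰp (θBal F.L γ b₀ p₀) (J + 1) J) U) ∧
              Real.log (ρ U) - a₀ - Real.log (heightDensityCan F γ (Nat.le_succ J) (histGood F ℰp (θBal F.L γ b₀ p₀) (J + 1) J) U) ≤ τ J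

/-- **MOD₁∘ · MODERATE LARGE FIELDS ON THE INTERIOR WINDOW** (`ModerateFieldOddsDepthOneIntCan`; v1.4): MOD₁ with the window fraction `c ∈ (0,1]` chosen right
after `∀ L`, the two WINDOW restrictions read at `θBal F.L γ (c * b₀) p₀ J`, the bad∕good HISTORY events unchanged at profile `b₀`.  On the `c`-interior the
sentence «the minimiser's own fine plaquettes are `≪ θ_{J+1}` up to the window's edge» of MOD₁'s docstring becomes TRUE by the choice `c < L^{3/2}∕(π_J C(L))`
(it is FALSE on the full window at `L = 3` for staggered data: R3-FLIN).  SHARED INPUT as MOD₁: GAP♯ at depth one. WHY IT MIGHT FAIL: as TAILSUP₁∘ (the price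
`C(L)`), plus MOD₁'s Laplace lower bound for the good fibre integral. [cite: Balaban1985UV3, Thm 2 p.263 and (38)-(41) p.266; Balaban1985Variational, Thm 1] -/
def ModerateFieldOddsDepthOneIntCan : Prop :=
  ∀ (L : ℕ), ∃ c₀ : ℝ, 0 < c₀ ∧ c₀ ≤ 1 ∧ ∀ (c : ℝ), 0 < c → c ≤ c₀ → ∃ pS : ℝ, ∀ (b₀ p₀ : ℝ), 0 < b₀ → pS ≤ p₀ → 0 < p₀ →
    ∃ δ₀ : ℝ, 0 < δ₀ ∧ ∃ γ₁ : ℝ, 0 < γ₁ ∧ ∀ (F : T3Family) (γ : ℝ), F.L = L → 0 < γ → γ ≤ γ₁ →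
      ∃ σ : ℕ → ℝ, (∀ J, 0 ≤ σ J) ∧ (∀ a : ℕ, Tendsto (fun J : ℕ => ((J : ℝ) + 1) ^ a * σ J) atTop (𝓝 0)) ∧
        ∀ J : ℕ,
          (Measure.map (descendTo F ℰp J (J + 1) (Nat.le_succ J))
              ((gibbsK F ℰp γ (J + 1)).restrict
                ((histGood F ℰp (θBal F.L γ b₀ p₀) (J + 1) J)ᶜ ∩
                  {V : GaugeField (F.P (J + 1)) 0 (Matrix.specialUnitaryGroup (Fin 2) ℂ) | PlaqSmall δ₀ V}))).restrict
              {U : GaugeField (F.P J) 0 (Matrix.specialUnitaryGroup (Fin 2) ℂ) | PlaqSmall (θBal F.L γ (c * b₀) p₀ J) U} ≤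
            ENNReal.ofReal (σ J) •
              (Measure.map (descendTo F ℰp J (J + 1) (Nat.le_succ J))
                  ((gibbsK F ℰp γ (J + 1)).restrict (histGood F ℰp (θBal F.L γ b₀ p₀) (J + 1) J))).restrict
                {U : GaugeField (F.P J) 0 (Matrix.specialUnitaryGroup (Fin 2) ℂ) | PlaqSmall (θBal F.L γ (c * b₀) p₀ J) U}

/-- **PPT∘ · PINNED MODERATE PLAQUETTE ON THE INTERIOR WINDOW** (`PinnedModerateOddsDepthOneIntCan`; v1.4): PPT with the window fraction `c` after `∀ L` and
the window at `θBal F.L γ (c * b₀) p₀ J`; pinned threshold `θBal F.L γ b₀ p₀ (J + 1)` and histories unchanged. [cite: Balaban1985UV3, (38)-(41) p.266] -/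
def PinnedModerateOddsDepthOneIntCan : Prop :=
  ∀ (L : ℕ), ∃ c₀ : ℝ, 0 < c₀ ∧ c₀ ≤ 1 ∧ ∀ (c : ℝ), 0 < c → c ≤ c₀ → ∃ pS : ℝ, ∀ (b₀ p₀ : ℝ), 0 < b₀ → pS ≤ p₀ → 0 < p₀ →
    ∃ δ₀ : ℝ, 0 < δ₀ ∧ ∃ γ₁ : ℝ, 0 < γ₁ ∧ ∀ (F : T3Family) (γ : ℝ), F.L = L → 0 < γ → γ ≤ γ₁ →
      ∃ σ : ℕ → ℝ, (∀ J, 0 ≤ σ J) ∧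
        (∀ a : ℕ, Tendsto (fun J : ℕ => ((J : ℝ) + 1) ^ a * ((Fintype.card (Plaq (F.P (J + 1)) 0) : ℝ) * σ J)) atTop (𝓝 0)) ∧
        ∀ (J : ℕ) (p : Plaq (F.P (J + 1)) 0),
          (Measure.map (descendTo F ℰp J (J + 1) (Nat.le_succ J))
              ((gibbsK F ℰp γ (J + 1)).restrict
                ({V : GaugeField (F.P (J + 1)) 0 (Matrix.specialUnitaryGroup (Fin 2) ℂ) |
                    θBal F.L γ b₀ p₀ (J + 1) ≤ dist1 (GaugeField.plaqHol V p)} ∩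
                  {V : GaugeField (F.P (J + 1)) 0 (Matrix.specialUnitaryGroup (Fin 2) ℂ) | PlaqSmall δ₀ V}))).restrict
              {U : GaugeField (F.P J) 0 (Matrix.specialUnitaryGroup (Fin 2) ℂ) | PlaqSmall (θBal F.L γ (c * b₀) p₀ J) U} ≤
            ENNReal.ofReal (σ J) •
              (Measure.map (descendTo F ℰp J (J + 1) (Nat.le_succ J))
                  ((gibbsK F ℰp γ (J + 1)).restrict (histGood F ℰp (θBal F.L γ b₀ p₀) (J + 1) J))).restrict
                {U : GaugeField (F.P J) 0 (Matrix.specialUnitaryGroup (Fin 2) ℂ) | PlaqSmall (θBal F.L γ (c * b₀) p₀ J) U}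

/-- ★ **PPT∘ → MOD₁∘** (PROVED: the union bound of §4d on the interior window; a bad depth-one history over an interior datum still has a `θ_{J+1}(b₀)`-large
finest plaquette because the interior window lies in the window, `setOf_plaqSmall_interior_subset`, at couplings `γ ≤ 1`). -/
theorem moderateFieldOddsInt_of_pinned (h : PinnedModerateOddsDepthOneIntCan) : ModerateFieldOddsDepthOneIntCan := by
  intro L
  obtain ⟨c₀, hc₀, hc₀1, H⟩ := h L
  refine ⟨c₀, hc₀, hc₀1, fun c hc0 hcc₀ => ?_⟩
  have hc1 : c ≤ 1 := hcc₀.trans hc₀1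
  obtain ⟨pS, H⟩ := H c hc0 hcc₀
  refine ⟨pS, fun b₀ p₀ hb hpS hp => ?_⟩
  obtain ⟨δ₀, hδ₀, γ₁, hγ₁, H⟩ := H b₀ p₀ hb hpS hp
  refine ⟨δ₀, hδ₀, min 1 γ₁, lt_min one_pos hγ₁, fun F γ hFL hγ hγle => ?_⟩
  have hWsub' := fun J => setOf_plaqSmall_interior_subset F hγ (hγle.trans (min_le_left _ _)) hb hc1 p₀ J
  obtain ⟨σ, hσ0, hσt, H⟩ := H F γ hFL hγ (hγle.trans (min_le_right _ _))
  refine ⟨fun J => (Fintype.card (Plaq (F.P (J + 1)) 0) : ℝ) * σ J, fun J => mul_nonneg (Nat.cast_nonneg _) (hσ0 J), hσt,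
    fun J => ?_⟩
  have hDm : Measurable (descendTo F ℰp J (J + 1) (Nat.le_succ J)) := measurable_descendTo F ℰp measurableE_ℰp _
  have hWm : MeasurableSet {U : GaugeField (F.P J) 0 (Matrix.specialUnitaryGroup (Fin 2) ℂ) | PlaqSmall (θBal F.L γ (c * b₀) p₀ J) U} :=
    (isOpen_setOf_plaqSmall₂ (F.P J) 0 _).measurableSet
  have hcov : ∀ V, descendTo F ℰp J (J + 1) (Nat.le_succ J) V ∈
      {U : GaugeField (F.P J) 0 (Matrix.specialUnitaryGroup (Fin 2) ℂ) | PlaqSmall (θBal F.L γ (c * b₀) p₀ J) U} →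
      V ∈ (histGood F ℰp (θBal F.L γ b₀ p₀) (J + 1) J)ᶜ ∩
          {V : GaugeField (F.P (J + 1)) 0 (Matrix.specialUnitaryGroup (Fin 2) ℂ) | PlaqSmall δ₀ V} →
      ∃ p : Plaq (F.P (J + 1)) 0, V ∈
        {V : GaugeField (F.P (J + 1)) 0 (Matrix.specialUnitaryGroup (Fin 2) ℂ) |
            θBal F.L γ b₀ p₀ (J + 1) ≤ dist1 (GaugeField.plaqHol V p)} ∩
          {V : GaugeField (F.P (J + 1)) 0 (Matrix.specialUnitaryGroup (Fin 2) ℂ) | PlaqSmall δ₀ V} := by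
    intro V hVW hV
    have hns := not_plaqSmall_of_not_mem_histGood_depthOne F (θBal F.L γ b₀ p₀) J V (hWsub' J hVW) hV.1
    simp only [PlaqSmall, not_forall, not_lt] at hns
    obtain ⟨p, hp⟩ := hns
    exact ⟨p, hp, hV.2⟩
  have key := restrict_map_le_card_mul_smul_of_pinned (gibbsK F ℰp γ (J + 1)) hDm hWm _ _ _ (ENNReal.ofReal (σ J)) hcov
    (fun p => H J p)
  rw [ENNReal.ofReal_mul (Nat.cast_nonneg _), ENNReal.ofReal_natCast]
  exact key

/-- The implication §4e certifies for the interior target (one named proposition; `windowOddsSupDepthOneIntCan_of_stubs` is its unique by-name concluder). -/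
def SplitOneIntSuffices : Prop := ModerateFieldOddsDepthOneIntCan → FarFieldOddsDepthOneCan → WindowOddsSupDepthOneIntCan

/-- ★ **COMPOSITION ON THE INTERIOR WINDOW (PROVED)**: the proof of §4 verbatim with `W := {PlaqSmall (θBal F.L γ (c * b₀) p₀ J)}`, couplings capped at
`γ ≤ 1`, FAR₁'s full-window bound RESTRICTED to the sub-window (`restrict_le_smul_restrict_of_subset`), the version lemma read at profile `c·b₀`, and WREG's
full-window regularity inherited by the sub-window. [cite: Balaban1985UV3, (2) p.256 and (6)-(7) p.257] -/
theorem windowOddsSupDepthOneInt_of_split : SplitOneIntSuffices := by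
  intro hM hF L
  obtain ⟨c₀, hc₀, hc₀1, HM⟩ := hM L
  obtain ⟨pS₂, HF⟩ := hF L
  refine ⟨c₀, hc₀, hc₀1, fun c hc0 hcc₀ => ?_⟩
  have hc1 : c ≤ 1 := hcc₀.trans hc₀1
  obtain ⟨pS₁, HM⟩ := HM c hc0 hcc₀
  refine ⟨max pS₁ pS₂, fun b₀ p₀ hb hpS hp => ?_⟩
  obtain ⟨δ₀, hδ₀, γM, hγM, HM⟩ := HM b₀ p₀ hb ((le_max_left _ _).trans hpS) hp
  obtain ⟨γF, hγF, HF⟩ := HF b₀ p₀ hb ((le_max_right _ _).trans hpS) hp δ₀ hδ₀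
  obtain ⟨γW, hγW, HW⟩ := windowRegularity L b₀ p₀ hb hp
  refine ⟨min 1 (min γM (min γF γW)), lt_min one_pos (lt_min hγM (lt_min hγF hγW)), fun F γ hFL hγ hγle => ?_⟩
  have hγ1 : γ ≤ 1 := hγle.trans (min_le_left _ _)
  replace hγle : γ ≤ min γM (min γF γW) := hγle.trans (min_le_right _ _)
  obtain ⟨σ₁, hσ₁0, hσ₁t, HM⟩ := HM F γ hFL hγ (hγle.trans (min_le_left _ _))
  obtain ⟨σ₂, hσ₂0, hσ₂t, HF⟩ := HF F γ hFL hγ (hγle.trans ((min_le_right _ _).trans (min_le_left _ _)))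
  have HW' := HW F γ hFL hγ (hγle.trans ((min_le_right _ _).trans (min_le_right _ _)))
  refine ⟨fun J => Real.log (1 + σ₁ J + σ₂ J), fun J => Real.log_nonneg (by linarith [hσ₁0 J, hσ₂0 J]),
    tendsto_pow_mul_log_one_add_add hσ₁0 hσ₂0 hσ₁t hσ₂t, ?_⟩
  intro ν hνK hνd J ρ hρpos hνρ hρcont hgpos
  -- the standing objects at height `J`, run `J + 1`
  haveI := B12ContinuousTransportInvariance.isOpenPosMeasure_fieldMeasure_SU (N := 2) (F.P J) 0
  set μ := fieldMeasure (F.P J) 0 (Matrix.specialUnitaryGroup (Fin 2) ℂ) with hμ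
  have hWsub := setOf_plaqSmall_interior_subset F hγ hγ1 hb hc1 p₀ J
  set W : Set (GaugeField (F.P J) 0 (Matrix.specialUnitaryGroup (Fin 2) ℂ)) := {U | PlaqSmall (θBal F.L γ (c * b₀) p₀ J) U} with hW
  set θ := θBal F.L γ b₀ p₀ with hθ
  set hist : Set (GaugeField (F.P (J + 1)) 0 (Matrix.specialUnitaryGroup (Fin 2) ℂ)) := histGood F ℰp θ (J + 1) J with hhist
  set Emod : Set (GaugeField (F.P (J + 1)) 0 (Matrix.specialUnitaryGroup (Fin 2) ℂ)) := histᶜ ∩ {V | PlaqSmall δ₀ V} with hEmod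
  set Efar : Set (GaugeField (F.P (J + 1)) 0 (Matrix.specialUnitaryGroup (Fin 2) ℂ)) := {V | ¬ PlaqSmall δ₀ V} with hEfar
  set G := gibbsK F ℰp γ (J + 1) with hG
  set D := descendTo F ℰp J (J + 1) (Nat.le_succ J) with hDdef
  set Z : ℝ := partitionFn (G := Matrix.specialUnitaryGroup (Fin 2) ℂ) (F.P (J + 1)) ((F.scheme ℰp γ).β (J + 1)) with hZ
  have hZpos : 0 < Z := partitionFn_pos' _ (F.scheme_β_nonneg ℰp hγ.le (J + 1))
  have hWo : IsOpen W := isOpen_setOf_plaqSmall₂ (F.P J) 0 _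
  have hWm : MeasurableSet W := hWo.measurableSet
  have hDm : Measurable D := measurable_descendTo F ℰp measurableE_ℰp _
  have hhistm : MeasurableSet hist := measurableSet_histGood F ℰp measurableE_ℰp θ (J + 1) J
  set hDu := heightDensity F γ (Nat.le_succ J) (Set.univ : Set (GaugeField (F.P (J + 1)) 0 (Matrix.specialUnitaryGroup (Fin 2) ℂ))) with hhDu
  set hDh := heightDensity F γ (Nat.le_succ J) hist with hhDh
  obtain ⟨hDum, -⟩ := heightDensity_props F (Nat.le_succ J)
    (S := (Set.univ : Set (GaugeField (F.P (J + 1)) 0 (Matrix.specialUnitaryGroup (Fin 2) ℂ)))) MeasurableSet.univ hγ.le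
  obtain ⟨hDhm, -⟩ := heightDensity_props F (Nat.le_succ J) (S := hist) hhistm hγ.le
  -- (1) the measure split: `D_* G |W ≤ (1 + σ₁ + σ₂) • D_*(G|hist) |W`
  have hM1 := HM J
  have hF1 : (Measure.map D (G.restrict Efar)).restrict W ≤ ENNReal.ofReal (σ₂ J) • (Measure.map D (G.restrict hist)).restrict W :=
    restrict_le_smul_restrict_of_subset hWm hWsub (HF J)
  have hsplit : G.restrict Set.univ ≤ G.restrict hist + G.restrict Emod + G.restrict Efar := by
    rw [Measure.le_iff]
    intro s hs
    simp only [Measure.add_apply, Measure.restrict_apply hs, Set.inter_univ]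
    calc G s ≤ G ((s ∩ hist ∪ s ∩ Emod) ∪ s ∩ Efar) := by
          refine measure_mono fun V hV => ?_
          by_cases h1 : V ∈ hist
          · exact Or.inl (Or.inl ⟨hV, h1⟩)
          · by_cases h2 : PlaqSmall δ₀ V
            · exact Or.inl (Or.inr ⟨hV, h1, h2⟩)
            · exact Or.inr ⟨hV, h2⟩
      _ ≤ G (s ∩ hist ∪ s ∩ Emod) + G (s ∩ Efar) := measure_union_le _ _
      _ ≤ G (s ∩ hist) + G (s ∩ Emod) + G (s ∩ Efar) := by
          gcongr
          exact measure_union_le _ _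
  have hmaple : Measure.map D (G.restrict Set.univ) ≤
      Measure.map D (G.restrict hist) + Measure.map D (G.restrict Emod) + Measure.map D (G.restrict Efar) := by
    have := Measure.map_mono hsplit hDm
    rwa [Measure.map_add _ _ hDm, Measure.map_add _ _ hDm] at this
  have hWle : (Measure.map D (G.restrict Set.univ)).restrict W ≤
      ENNReal.ofReal (1 + σ₁ J + σ₂ J) • (Measure.map D (G.restrict hist)).restrict W := by
    have h3 : (Measure.map D (G.restrict Set.univ)).restrict W ≤
        (Measure.map D (G.restrict hist)).restrict W + (Measure.map D (G.restrict Emod)).restrict W +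
          (Measure.map D (G.restrict Efar)).restrict W := by
      have := Measure.restrict_mono (s := W) (s' := W) le_rfl hmaple
      rwa [Measure.restrict_add, Measure.restrict_add] at this
    refine h3.trans ?_
    have hsum : ENNReal.ofReal (1 + σ₁ J + σ₂ J) = 1 + ENNReal.ofReal (σ₁ J) + ENNReal.ofReal (σ₂ J) := by
      rw [ENNReal.ofReal_add (by linarith [hσ₁0 J]) (hσ₂0 J), ENNReal.ofReal_add zero_le_one (hσ₁0 J), ENNReal.ofReal_one]
    rw [hsum, add_smul, add_smul, one_smul]
    gcongr
  -- (2) the `withDensity` presentation ⇒ a.e. inequalities of the height densities on `W`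
  have eU : Measure.map D (G.restrict Set.univ) = μ.withDensity (fun U => ENNReal.ofReal (Z⁻¹ * hDu U)) :=
    map_descendTo_restrict_eq_withDensity F (Nat.le_succ J) MeasurableSet.univ hγ.le
  have eH : Measure.map D (G.restrict hist) = μ.withDensity (fun U => ENNReal.ofReal (Z⁻¹ * hDh U)) :=
    map_descendTo_restrict_eq_withDensity F (Nat.le_succ J) hhistm hγ.le
  have hfu_m : Measurable (fun U => ENNReal.ofReal (Z⁻¹ * hDu U)) := (hDum.const_mul _).ennreal_ofReal
  have hfh_m : Measurable (fun U => ENNReal.ofReal (Z⁻¹ * hDh U)) := (hDhm.const_mul _).ennreal_ofReal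
  have hWle' : (μ.restrict W).withDensity (fun U => ENNReal.ofReal (Z⁻¹ * hDu U)) ≤
      (μ.restrict W).withDensity (fun U => ENNReal.ofReal (1 + σ₁ J + σ₂ J) * ENNReal.ofReal (Z⁻¹ * hDh U)) := by
    have h := hWle
    rw [eU, eH, restrict_withDensity hWm, restrict_withDensity hWm] at h
    refine h.trans (le_of_eq ?_)
    rw [← withDensity_smul _ hfh_m]
    rfl
  have hae1 : (fun U => ENNReal.ofReal (Z⁻¹ * hDu U)) ≤ᵐ[μ.restrict W]
      fun U => ENNReal.ofReal (1 + σ₁ J + σ₂ J) * ENNReal.ofReal (Z⁻¹ * hDh U) := by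
    refine ae_le_of_forall_setLIntegral_le_of_sigmaFinite hfu_m fun s hs _ => ?_
    rw [← withDensity_apply _ hs, ← withDensity_apply _ hs]
    exact Measure.le_iff'.1 hWle' s
  have hae1' : ∀ᵐ U ∂μ.restrict W, hDu U ≤ (1 + σ₁ J + σ₂ J) * hDh U := by
    filter_upwards [hae1] with U hU
    have hs0 : 0 ≤ 1 + σ₁ J + σ₂ J := by linarith [hσ₁0 J, hσ₂0 J]
    rw [← ENNReal.ofReal_mul hs0] at hU
    have hU' := (ENNReal.ofReal_le_ofReal_iff (mul_nonneg hs0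
      (mul_nonneg (inv_nonneg.mpr hZpos.le) (heightDensity_nonneg F γ _ _ U)))).mp hU
    have hZi : 0 < Z⁻¹ := inv_pos.mpr hZpos
    nlinarith [hU', heightDensity_nonneg F γ (Nat.le_succ J) hist U, heightDensity_nonneg F γ (Nat.le_succ J) Set.univ U]
  have hae2 : hDh ≤ᵐ[μ] hDu := heightDensity_mono_ae F (Nat.le_succ J) hhistm MeasurableSet.univ (subset_univ _) hγ.le
  -- (3) the canonical versions are continuous on the open window: WREG (hist) and the version `ρ` (univ)
  obtain ⟨hWregHfull, -⟩ := HW' J (J + 1) (Nat.le_succ J) γ hγ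
  have hWregH : W ⊆ Node00.regSet μ hDh := hWsub.trans hWregHfull
  obtain ⟨hWregU, hEqU⟩ := subset_regSet_heightDensity_univ_of_version F (c * b₀) p₀ hγ ν hνK hνd (Nat.le_succ J) ρ hρpos hνρ hρcont
  set Qu := heightDensityCan F γ (Nat.le_succ J) (Set.univ : Set (GaugeField (F.P (J + 1)) 0 (Matrix.specialUnitaryGroup (Fin 2) ℂ))) with hQu
  set Qh := heightDensityCan F γ (Nat.le_succ J) hist with hQh
  have hQu_cont : ContinuousOn Qu W := Node00.continuousOn_canonVersion.mono hWregU
  have hQh_cont : ContinuousOn Qh W := Node00.continuousOn_canonVersion.mono hWregH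
  have hQuZ : ∀ U ∈ W, Qu U = Z * ρ U := fun U hU => hEqU hU
  -- (4) pointwise on `W`
  have hup : ∀ U ∈ W, Qu U ≤ (1 + σ₁ J + σ₂ J) * Qh U := by
    intro U hU
    refine le_of_ae_le_of_continuousOn (μ := μ) hWo hQu_cont (continuousOn_const.mul hQh_cont) ?_ hU
    filter_upwards [hae1', ae_restrict_of_ae (Node00.canonVersion_ae_eq (μ := μ) (f := hDu)),
      ae_restrict_of_ae (Node00.canonVersion_ae_eq (μ := μ) (f := hDh))] with V h1 h2 h3
    show Node00.canonVersion μ hDu V ≤ (1 + σ₁ J + σ₂ J) * Node00.canonVersion μ hDh V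
    rw [h2, h3]
    exact h1
  have hlow : ∀ U ∈ W, Qh U ≤ Qu U := fun U hU =>
    canonVersion_le_of_ae_le_on hWo hWregH hWregU (ae_restrict_of_ae hae2) hU
  -- (5) the odds
  refine ⟨-Real.log Z, fun U hU => ?_⟩
  have hUW : U ∈ W := hU
  have hQh_pos : 0 < Qh U := hgpos U hU
  have hρU : 0 < ρ U := hρpos U hU
  have hQu_pos : 0 < Qu U := by rw [hQuZ U hUW]; exact mul_pos hZpos hρU
  have hlogρ : Real.log (ρ U) = Real.log (Qu U) - Real.log Z := by
    rw [hQuZ U hUW, Real.log_mul hZpos.ne' hρU.ne']; ring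
  have hs0 : 0 < 1 + σ₁ J + σ₂ J := by linarith [hσ₁0 J, hσ₂0 J]
  have e : Real.log (ρ U) - -Real.log Z - Real.log (Qh U) = Real.log (Qu U) - Real.log (Qh U) := by rw [hlogρ]; ring
  refine ⟨?_, ?_⟩
  · show 0 ≤ Real.log (ρ U) - -Real.log Z - Real.log (Qh U)
    rw [e, sub_nonneg]
    exact Real.log_le_log hQh_pos (hlow U hUW)
  · show Real.log (ρ U) - -Real.log Z - Real.log (Qh U) ≤ Real.log (1 + σ₁ J + σ₂ J)
    rw [e, sub_le_iff_le_add, ← Real.log_mul hs0.ne' hQh_pos.ne']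
    exact Real.log_le_log hQu_pos (hup U hUW)

/-- ★ **PPT∘ → FPT → TAILSUP₁∘** (the pinned interior row and the pinned far row suffice). -/
theorem windowOddsSupDepthOneInt_of_pinned (h₁ : PinnedModerateOddsDepthOneIntCan) (h₂ : PinnedFarOddsDepthOneCan) :
    WindowOddsSupDepthOneIntCan :=
  windowOddsSupDepthOneInt_of_split (moderateFieldOddsInt_of_pinned h₁) (farFieldOdds_of_pinned h₂)

end Interior

/-! ## §5 Stubs (the rows' sorries) and the TAILSUP₁ this file delivers -/

section Stubs

/-- MOD₁ — L: Laplace∕Gaussian-tail relative bound on the one-step constrained fibre (GAP♯-type convexity on a `δ₀`-chart; NeumannFRD #158 as proxy). -/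
theorem stub_moderateFieldOddsDepthOneCan : ModerateFieldOddsDepthOneCan := by
  sorry

/-- FAR₁ — M–L: action-cost («remove the bad plaquette») relative bound on the constrained fibre, every `δ₀ > 0`, `γ ≤ γ₁(δ₀)`. -/
theorem stub_farFieldOddsDepthOneCan : FarFieldOddsDepthOneCan := by
  sorry

/-- **THE TAILSUP₁ THIS FILE DELIVERS** (modulo its two sorries). -/
theorem windowOddsSupDepthOneCan_of_stubs : WindowOddsSupDepthOneCan :=
  windowOddsSupDepthOne_of_split stub_moderateFieldOddsDepthOneCan stub_farFieldOddsDepthOneCan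

/-- MOD₁∘ — OPEN (v1.4; the LIVE moderate row after R3-FLIN: window fraction `c(L)`, history profile `b₀`). -/
theorem stub_moderateFieldOddsDepthOneIntCan : ModerateFieldOddsDepthOneIntCan := by
  sorry

/-- ★ TAILSUP₁∘ from the interior stub and FAR₁ (the unique by-name concluder of `WindowOddsSupDepthOneIntCan` from stubs). -/
theorem windowOddsSupDepthOneIntCan_of_stubs : WindowOddsSupDepthOneIntCan :=
  windowOddsSupDepthOneInt_of_split stub_moderateFieldOddsDepthOneIntCan stub_farFieldOddsDepthOneCan

end Stubs

end Summit.QuantumFields.YangMills.Cruxes.FluctuationComparisonRegPrIntL.RunPairOrgan.TailSupOne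

end
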